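import Literature.NumberTheory.LFunctions.BaezDuarteMellinProperCriterionProofs
import Literature.NumberTheory.LFunctions.HardyLittlewoodCriterionProofs
import Literature.NumberTheory.LFunctions.LandauOscillation
import Literature.NumberTheory.LFunctions.ZetaRealAxis
import Mathlib.NumberTheory.Harmonic.ZetaAsymp
import HarnessLib

/-!
# RH-CRITERION LITERATURE (PROVED, unconditional) · Báez-Duarte 2005, IJMMS Thm. 4.4: the oscillations of `g(x) = Σ_{n≤x} μ(n)/n` are transmitted to `Gφ` (Landau's theorem; boundary exponent `1/2`, off-line zeros, corrected range `ϑ ∈ [0,1/2]`), the Hardy–Littlewood function `H` and Riesz's function `R` have infinitely many positive zeros, and the unconditional `L²` clauses of Thms 2.3/4.2 — nothing here bears on the truth of RH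

L. Báez-Duarte, *Möbius-convolutions and the Riemann hypothesis*, IJMMS 2005:22, 3599–3608,
**Theorem 4.4** (p. 3607, (4.14); in the published version only): "If `φ` is real and
Mellin-proper, then there exists a `ϑ ∈ [0, 1/2)` such that `liminf_{x→+∞} x^{ϑ+ε} Gφ(x) = −∞`,
`limsup_{x→+∞} x^{ϑ+ε} Gφ(x) = +∞` for all `ε > 0`" — "the infinite number of oscillations of
`g(x)` is transmitted to `Gφ(x)` unconditionally". Printed proof: `f(s) = ∫₁^∞ x^{−s−1}Gφ(x) dx =
h(s) + φ^∧(s)/(sζ(s+1))` ((4.13)) has "abscissa of convergence `α ∈ (−1/2, 0]`. It is obvious that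
`s = α` cannot be a singularity of `f(s)`, therefore the oscillation Lemma 2.2 of [1], based on
Landau's theorem for Laplace transforms, yields the conclusion that `ϑ = −α`."

## What is proved, and the as-printed caveat

`BaezDuarteMellinProperCriterionProofs.lean` §15 records (kernel-checked,
`BaezDuarte2005Moebius_thm_4_4_range_of_riemannHypothesis`) that under RH the abscissa is
`α = −1/2` for every proper `φ` (Thm. 3.5), so the printed range `ϑ ∈ [0,1/2)` / "`α ∈ (−1/2, 0]`"
tacitly assumes `α > −1/2`. What the printed Landau argument gives in general is the statement AT
the boundary exponent `ϑ = 1/2`, and that is proved here, unconditionally: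

* `BaezDuarte2005Moebius_thm_4_4_boundary` — for real `φ` (`Im φ = 0` on `(0,∞)`) whose norms
  `N_σ(φ)` are finite on an open interval `(−1/2−δ₀, δ₀) ⊇ [−1/2, 0]` (so that `φ^∧/(sζ(s+1))` and
  `h` are holomorphic near the real segment `[−1/2, 0]`, which "`s = α` cannot be a singularity"
  needs) and with `φ^∧ ≠ 0` on `−1/2 ≤ Re s < 0` (Mellin-proper, and on the line as in Thm. 4.1):
  for every `ε > 0` and every real `C`, `x^{1/2+ε} Gφ(x) > C` for arbitrarily large `x` and
  `x^{1/2+ε} Gφ(x) < C` for arbitrarily large `x` (`limsup = +∞`, `liminf = −∞`).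

* `BaezDuarte2005Moebius_thm_4_4_offLine` — the printed range realised: if `ζ(ρ₀) = 0` with
  `1/2 < Re ρ₀ < 1`, then (real Mellin-proper `φ`, norms finite on `(−1/2, δ₀)`) the same
  oscillation holds at the exponent `ϑ = 1 − Re ρ₀ ∈ (0, 1/2)` — the printed "`ϑ = −α`" for the pole
  `ρ₀ − 1` of `φ^∧(s)/(sζ(s+1))`.
* `BaezDuarte2005Moebius_thm_4_4_corrected` — the two cases assembled (classically, on RH): under
  the hypotheses of the boundary form there is `ϑ ∈ [0, 1/2]` with (4.14) for every `ε > 0`; the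
  printed half-open range `[0, 1/2)` is exactly the case "RH false".

* `hardyLittlewoodFunction_oscillation`, `hardyLittlewoodFunction_frequently_pos_and_neg` — the
  concrete, hypothesis-free case `φ = β` (`H(x²) = Gβ(x)`, (3.7)): the Hardy–Littlewood function
  `H(x) = Σ_{k≥1} (−x)^k/(k! ζ(2k+1))` satisfies (4.14) for some `ϑ ∈ [0,1/2]`, in particular it
  changes sign beyond every bound, hence (`hardyLittlewoodFunction_exists_zero_gt`,
  `hardyLittlewoodFunction_zeros_infinite`, by continuity of `H`) has "an infinite number of
  positive, real zeros" (IJMMS §1, p. 3600), unconditionally.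

* `BaezDuarte2005Moebius_thm_2_3_normSq` and `BaezDuarte2005Moebius_thm_4_2_normSq` — the
  UNCONDITIONAL clauses "`‖g₁‖₂ = ∞`" of Thm. 2.3 ((2.14)) and "`‖ψ‖₂ = ∞` if `φ^∧ ∈ A[−1/2,0)` does
  not vanish on `σ = −1/2`" of Thm. 4.2 ((4.6)), completing both theorems as printed (their
  equivalence parts are `BaezDuarte2005Moebius_thm_2_3` / `_thm_4_2` in
  `BaezDuarteMellinProperCriterionProofs.lean`). Printed road: `f(x) = ∫₀^x g` (resp. `∫₀^x Gφ`),
  poles of its Mellin transform on `Re s = 1/2`, [1, Lemma 2.1] (order) and [1, Lemma 2.3]; here the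
  Cauchy–Schwarz step is done directly on `g` (resp. `Gφ`) in Young's form —
  `N_{−1/2+h} ≤ M h^{−1/2}` (`BaezDuarteMellin.integral_rpow_mul_norm_le_of_sq_integrable`) — against
  the pole at the certified critical zero (`‖ζ(ρ+h)‖ ≤ K h`), which forces `1 ≤ K L M √h → 0`.

* `BaezDuarte2005Moebius_thm_2_3_asPrinted`, `BaezDuarte2005Moebius_thm_4_2_asPrinted` — both
  clauses of Thms 2.3 and 4.2 in one statement each; `BaezDuarte2005Moebius_signChange` — the
  remark after (4.13) (p. 3607): for real proper `φ` with `∫₀^∞ φ dt/t = 0`, `Gφ` changes sign on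
  `(0,∞)` unless it vanishes a.e. ((3.11)).

* Riesz's test function `α(x) = x(1 − 2x²)e^{−x²}` ((1.2)): `BaezDuarteMellin.hasFiniteMellinNorm_hlAlpha`
  (`σ < 1`), `BaezDuarteMellin.leftMellin_hlAlpha` (`α^∧(s) = (s/2)Γ((1−s)/2)`, `Re s < 1`),
  `BaezDuarteMellin.isMellinProper_hlAlpha` ("both α and β are Mellin-proper", p. 3604), and
  `BaezDuarteMellin.moebiusConv_hlAlpha_eq` ((3.7): `x⁻¹R(x²) = Gα(x)`, Abel summation as for
  `Gβ = H(x²)`), `moebiusConv_hlAlpha_oscillation` / `rieszFunction_oscillation` (Thm. 4.4,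
  corrected range, for `Gα = x⁻¹R(x²)`), `rieszFunction_frequently_pos_and_neg`,
  `rieszFunction_exists_zero_gt`, `rieszFunction_zeros_infinite`: **Riesz's function `R` has
  infinitely many positive real zeros**, unconditionally ("in contrast with Riesz's statement that
  `R(x)` has at least one such zero", p. 3600).

Mechanism (`BaezDuarteMellin.hasFiniteMellinNorm_moebiusConv_of_oneSided_rpow`, general exponent;
`…_of_oneSided`, the boundary case): a one-sided bound
`±Gφ(x) ≤ C x^{−1/2−ε}` (`x ≥ X`) makes `A(x) = C x^{−1/2−ε} ∓ Gφ(x) ≥ 0` with Mellin transform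
`C/(s+1/2+ε) ∓ (φ^∧(s)/(sζ(s+1)) − h(s))`, `h(s) = ∫₀¹ x^{−s−1}Gφ`, holomorphic on a neighbourhood of
the real segment `(−1/2−ε/2, 2]` — no real zeros of `ζ(s+1)` (`ζ < 0` on `(0,1)`, tree
`ZetaRealAxis`), no zeros with `0 < |Im| < 1` (the certified `N(14) = 0`, tree
`ZetaFirstZeroCertificate`), a removable singularity at `s = 0` (`s ζ(s+1) → 1`) — so Landau's lemma
(tree `Landau.integrableOn_of_differentiableOn_union_convex`, MV Lemma 15.1) gives
`N_{−1/2−ε/4}(Gφ) < ∞`, contradicting "`α ≥ −1/2`"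
(`BaezDuarteMellin.not_hasFiniteMellinNorm_moebiusConv_of_lt`, via the certified critical zero) — or,
for an off-line zero `ρ₀`, contradicting `N_σ(Gφ) = ∞` for `σ < Re ρ₀ − 1`
(`BaezDuarteMellin.not_hasFiniteMellinNorm_moebiusConv_of_lt_re_zero`, from (3.11) on the narrower
strip `a < Re s < 0`: `leftMellin_moebiusConv_mul_eq_of_hasFiniteMellinNorm_of_lt`, with the
strip-width-free boundary uniqueness `eq_zero_of_eqOn_boundary_segment_of_lt` built on the tree's
half-disc lemma `Literature.Analysis.Complex.eqOn_zero_of_eqOn_real_diameter`).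

Supporting lemmas (namespace `BaezDuarteMellin`): `riemannZeta_ne_zero_of_abs_im_le_fourteen`,
`tendsto_mul_riemannZeta_add_one` (`sζ(s+1) → 1`), `analyticAt_invMulZeta_zero` /
`differentiableAt_invMulZeta` / `leftMellin_moebiusDivSum_eq_invMulZeta` (the filled-in
`1/(sζ(s+1))`, written as `Function.update (fun s ↦ (s ζ(s+1))⁻¹) 0 1`; no definition introduced),
`moebiusConv_im_eq_zero` (`Gφ` is real for real `φ`), `exists_norm_moebiusConv_le_rpow` (decay
`Gφ(x) ≪ x^{σ'}` at `0` from `N_{σ'}(φ) < ∞`, `σ' > 0`), `hasFiniteMellinNorm_indicator_moebiusConv`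
and `leftMellin_indicator_moebiusConv` (the truncation `h`), `integral_rpow_mul_cpow_Ioi_one`.

No definitions, no named facts; standard axioms. Nothing here bears on the truth of RH.

## References

* L. Báez-Duarte, *Möbius-convolutions and the Riemann hypothesis*, Int. J. Math. Math. Sci.
  2005:22 (2005) 3599–3608, Thm. 4.4 (4.14), Prop. 4.3 (4.13), Thm. 3.5; arXiv:math/0504402 (v1 lacks
  §4.2–4.4). [BaezDuarte2005Moebius]
* H. L. Montgomery, R. C. Vaughan, *Multiplicative Number Theory I* (2007), §15.1 Lemma 15.1
  (Landau). [MontgomeryVaughan2007]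
* H. M. Edwards, *Riemann's Zeta Function* (1974), §6.6 (first zeros). [Edwards1974]
-/

noncomputable section

open Filter Asymptotics Topology MeasureTheory Set
open Complex (I)
open scoped ComplexConjugate

namespace Literature.NumberTheory.LFunctions

namespace BaezDuarteMellin

/-- `ζ(w) ≠ 0` for `0 < Re w`, `|Im w| ≤ 14`, `w ≠ 1`: above the real axis this is the tree's
certified `N(14) = 0`, below it follows by conjugation, and on the real axis `ζ(σ) < 0` on `(0,1)`
and `ζ(σ) ≠ 0` for `σ > 1`. [cite: Edwards1974, §6.6] -/
theorem riemannZeta_ne_zero_of_abs_im_le_fourteen {w : ℂ} (hre : 0 < w.re) (him : |w.im| ≤ 14)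
    (hw1 : w ≠ 1) : riemannZeta w ≠ 0 := by
  rcases lt_trichotomy w.im 0 with h | h | h
  · -- lower half-plane: conjugate
    have h' : 0 < (conj w).im := by simp [h]
    have h14 : (conj w).im ≤ 14 := by
      simp only [Complex.conj_im]
      linarith [(abs_le.1 him).1]
    have hne := riemannZeta_ne_zero_of_im_pos_of_im_le_fourteen h' h14
    rw [riemannZeta_conj] at hne
    exact fun h0 => hne (by rw [h0, map_zero])
  · -- real axis
    rcases lt_trichotomy w.re 1 with h1 | h1 | h1
    · exact riemannZeta_ne_zero_of_im_eq_zero_of_pos_of_lt_one h hre h1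
    · exact absurd (Complex.ext (by simp [h1]) (by simp [h])) hw1
    · exact riemannZeta_ne_zero_of_one_lt_re h1
  · exact riemannZeta_ne_zero_of_im_pos_of_im_le_fourteen h (abs_le.1 him).2

/-- The reciprocal `1/(s ζ(s+1))` with its removable singularity at `s = 0` filled in (value `1`,
the residue of `ζ` at `1`) — written throughout as the explicit expression
`Function.update (fun s ↦ (s ζ(s+1))⁻¹) 0 1` (no definition is introduced): off `0` it is
`(s ζ(s+1))⁻¹`. [cite: BaezDuarte2005Moebius, §2 eq. (2.12)–(2.13)] -/
theorem invMulZeta_of_ne_zero {s : ℂ} (hs : s ≠ 0) :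
    (Function.update (fun s : ℂ => (s * riemannZeta (s + 1))⁻¹) 0 1) s = (s * riemannZeta (s + 1))⁻¹ := by
  simp [hs]

/-- `s ζ(s+1) → 1` as `s → 0`, `s ≠ 0`. [cite: BaezDuarte2005Moebius, §2 eq. (2.13)] -/
theorem tendsto_mul_riemannZeta_add_one :
    Tendsto (fun s : ℂ => s * riemannZeta (s + 1)) (𝓝[≠] 0) (𝓝 1) := by
  have hmap : Tendsto (fun s : ℂ => s + 1) (𝓝[≠] (0 : ℂ)) (𝓝[≠] 1) := by
    refine tendsto_nhdsWithin_iff.2 ⟨?_, ?_⟩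
    · have h := ((continuous_id.tendsto (0 : ℂ)).add_const (1 : ℂ)).mono_left
        (nhdsWithin_le_nhds (s := ({0}ᶜ : Set ℂ)))
      simpa using h
    · filter_upwards [self_mem_nhdsWithin] with s hs
      simpa using hs
  have h := riemannZeta_residue_one.comp hmap
  refine h.congr fun s => ?_
  simp

/-- The filled-in reciprocal `1/(sζ(s+1))` is analytic at `0` (removable singularity). [cite: BaezDuarte2005Moebius, §2 eq. (2.12)–(2.13)] -/
theorem analyticAt_invMulZeta_zero :
    AnalyticAt ℂ (Function.update (fun s : ℂ => (s * riemannZeta (s + 1))⁻¹) 0 1) 0 := by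
  have hne : ∀ᶠ s in 𝓝[≠] (0 : ℂ), s * riemannZeta (s + 1) ≠ 0 :=
    (tendsto_mul_riemannZeta_add_one.eventually_ne one_ne_zero)
  refine Complex.analyticAt_of_differentiable_on_punctured_nhds_of_continuousAt ?_ ?_
  · filter_upwards [hne, self_mem_nhdsWithin] with s hs hs0
    have hs0' : s ≠ 0 := hs0
    have hζ : riemannZeta (s + 1) ≠ 0 := fun h => hs (by rw [h, mul_zero])
    have hs1 : s + 1 ≠ 1 := by simpa using hs0'
    have hd : DifferentiableAt ℂ (fun z : ℂ => (z * riemannZeta (z + 1))⁻¹) s :=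
      (differentiableAt_id.mul ((differentiableAt_riemannZeta hs1).comp s
        (f := fun z : ℂ => z + 1) (differentiableAt_id.add_const 1))).inv hs
    refine hd.congr_of_eventuallyEq ?_
    filter_upwards [isOpen_compl_singleton.mem_nhds hs0'] with z hz
    exact invMulZeta_of_ne_zero hz
  · rw [continuousAt_update_same]
    simpa using tendsto_mul_riemannZeta_add_one.inv₀ one_ne_zero

/-- The filled-in reciprocal `1/(sζ(s+1))` is differentiable at every `s ≠ 0` with `ζ(s+1) ≠ 0`. [cite: BaezDuarte2005Moebius, §2 eq. (2.12)] -/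
theorem differentiableAt_invMulZeta {s : ℂ} (hs : s ≠ 0) (hζ : riemannZeta (s + 1) ≠ 0) :
    DifferentiableAt ℂ (Function.update (fun s : ℂ => (s * riemannZeta (s + 1))⁻¹) 0 1) s := by
  have hs1 : s + 1 ≠ 1 := by simpa using hs
  have hd : DifferentiableAt ℂ (fun z : ℂ => (z * riemannZeta (z + 1))⁻¹) s :=
    (differentiableAt_id.mul ((differentiableAt_riemannZeta hs1).comp s
      (f := fun z : ℂ => z + 1) (differentiableAt_id.add_const 1))).inv (mul_ne_zero hs hζ)
  refine hd.congr_of_eventuallyEq ?_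
  filter_upwards [isOpen_compl_singleton.mem_nhds hs] with z hz
  exact invMulZeta_of_ne_zero hz

/-- `g^∧(s) = 1/(sζ(s+1))` (the filled-in reciprocal) for `Re s > 0` ((2.12)). [cite: BaezDuarte2005Moebius, §2 eq. (2.12)] -/
theorem leftMellin_moebiusDivSum_eq_invMulZeta {s : ℂ} (hs : 0 < s.re) :
    leftMellin (fun x : ℝ => (moebiusDivSum x : ℂ)) s =
      (Function.update (fun s : ℂ => (s * riemannZeta (s + 1))⁻¹) 0 1) s := by
  have hs0 : s ≠ 0 := by
    intro h; rw [h] at hs; simp at hs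
  have h := riemannZeta_mul_leftMellin_moebiusDivSum hs
  have hζ : riemannZeta (s + 1) ≠ 0 := by
    intro h0; rw [h0, zero_mul] at h; exact zero_ne_one h
  rw [invMulZeta_of_ne_zero hs0]
  field_simp
  linear_combination h

/-- `Gφ` is real when `φ` is real on `(0, ∞)`. [cite: BaezDuarte2005Moebius, §4 Thm. 4.4 ("if φ is real")] -/
theorem moebiusConv_im_eq_zero {φ : ℝ → ℂ} (hreal : ∀ u : ℝ, 0 < u → (φ u).im = 0) (x : ℝ) :
    (moebiusConv φ x).im = 0 := by
  unfold moebiusConv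
  by_cases hint : Integrable (fun t : ℝ => (moebiusDivSum (x * t) : ℂ) * φ (1 / t) / t)
      (volume.restrict (Ioi (0 : ℝ)))
  · have h := integral_im hint
    rw [← RCLike.im_to_complex, ← h]
    refine setIntegral_eq_zero_of_forall_eq_zero fun t ht => ?_
    have ht0 : (0 : ℝ) < t := ht
    simp only [RCLike.im_to_complex, Complex.div_ofReal_im, Complex.mul_im, Complex.ofReal_re,
      Complex.ofReal_im, zero_mul, add_zero, hreal (1 / t) (by positivity), mul_zero, zero_div]
  · rw [integral_undef hint, Complex.zero_im]

/-- `Gφ(x) = Re Gφ(x)` for real `φ`. [cite: BaezDuarte2005Moebius, §4 Thm. 4.4 ("if φ is real")] -/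
theorem ofReal_re_moebiusConv {φ : ℝ → ℂ} (hreal : ∀ u : ℝ, 0 < u → (φ u).im = 0) (x : ℝ) :
    (((moebiusConv φ x).re : ℝ) : ℂ) = moebiusConv φ x :=
  Complex.ext (by simp) (by simp [moebiusConv_im_eq_zero hreal x])

/-- Decay of `Gφ` at `0`: if `N_{σ'}(φ) < ∞` for some `σ' > 0` then `‖Gφ(x)‖ ≤ K x^{σ'}` for all
`x > 0` (`|g| ≤ B ≤ B u^{σ'}` on `u ≥ 1` in the majorant (3.16)). [cite: BaezDuarte2005Moebius, §3 (3.16) and Lemma 3.2] -/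
theorem exists_norm_moebiusConv_le_rpow {φ : ℝ → ℂ} {σ' : ℝ} (hσ' : 0 < σ')
    (hN : HasFiniteMellinNorm φ σ') :
    ∃ K : ℝ, 0 ≤ K ∧ ∀ x : ℝ, 0 < x → ‖moebiusConv φ x‖ ≤ K * x ^ σ' := by
  obtain ⟨B, hB, hgB⟩ := exists_abs_moebiusDivSum_le
  unfold HasFiniteMellinNorm at hN
  refine ⟨B * ∫ u in Ioi (0 : ℝ), u ^ (-σ' - 1) * ‖φ u‖, ?_, fun x hx => ?_⟩
  · exact mul_nonneg hB.le (setIntegral_nonneg measurableSet_Ioi fun u hu =>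
      mul_nonneg (Real.rpow_nonneg (le_of_lt (α := ℝ) hu) _) (norm_nonneg _))
  · refine norm_moebiusConv_le_of_bound hB.le (fun u hu => ?_) hN hx
    exact (hgB u).trans (le_mul_of_one_le_right hB.le (Real.one_le_rpow hu hσ'.le))

/-- `∫₁^∞ x^c · x^{−(s+1)} dx = 1/(s − c)` for `Re s > c`. [folklore] -/
private theorem integral_rpow_mul_cpow_Ioi_one {c : ℝ} {s : ℂ} (hs : c < s.re) :
    ∫ x in Ioi (1 : ℝ), ((x ^ c : ℝ) : ℂ) * (x : ℂ) ^ (-(s + 1)) = 1 / (s - c) := by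
  have heq : EqOn (fun x : ℝ => ((x ^ c : ℝ) : ℂ) * (x : ℂ) ^ (-(s + 1)))
      (fun x : ℝ => (x : ℂ) ^ ((c : ℂ) - s - 1)) (Ioi 1) := by
    intro x hx
    have hx0 : (0 : ℝ) < x := lt_trans zero_lt_one hx
    have hx' : (x : ℂ) ≠ 0 := Complex.ofReal_ne_zero.2 hx0.ne'
    simp only
    rw [Complex.ofReal_cpow hx0.le, ← Complex.cpow_add _ _ hx']
    congr 1; ring
  rw [setIntegral_congr_fun measurableSet_Ioi heq,
    integral_Ioi_cpow_of_lt (by simp; linarith) zero_lt_one]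
  have hsc : (c : ℂ) - s - 1 + 1 ≠ 0 := by
    intro h
    have := congrArg Complex.re h
    simp at this
    linarith
  rw [Complex.ofReal_one, Complex.one_cpow]
  have hsc' : s - (c : ℂ) ≠ 0 := by
    intro h; apply hsc; linear_combination -h
  field_simp
  ring

/-- Integrability of `x^c · x^{−(s+1)}` on `(1, ∞)` for `Re s > c` (real form). [folklore] -/
private theorem integrableOn_rpow_mul_rpow_Ioi_one {c σ : ℝ} (hσ : c < σ) :
    IntegrableOn (fun x : ℝ => x ^ c * x ^ (-(σ + 1))) (Ioi 1) := by
  refine ((integrableOn_Ioi_rpow_of_lt (show c + (-(σ + 1)) < -1 by linarith) zero_lt_one)).congr_fun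
    (fun x hx => ?_) measurableSet_Ioi
  simp only [Real.rpow_add (lt_trans zero_lt_one hx)]


/-- The weighted norms of the truncation `Gφ·𝟙_{(0,1]}` are finite at every `σ < σ'` as soon as
`N_{σ'}(φ) < ∞` for some `σ' > 0` (decay `Gφ(x) ≪ x^{σ'}` at `0`): its Mellin transform
`h(s) = ∫₀¹ x^{−s−1}Gφ(x) dx` is holomorphic on `Re s < σ'` (the paper's `h ∈ A(−∞, 0]`, Lemma 3.3,
pushed slightly to the right). [cite: BaezDuarte2005Moebius, Lemma 3.3 (arXiv Lemma 3.2)] -/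
theorem hasFiniteMellinNorm_indicator_moebiusConv {φ : ℝ → ℂ} (hφm : Measurable φ) {σ' : ℝ}
    (hσ' : 0 < σ') (hN : HasFiniteMellinNorm φ σ') {σ : ℝ} (hσ : σ < σ') :
    HasFiniteMellinNorm ((Ioc (0 : ℝ) 1).indicator (moebiusConv φ)) σ := by
  obtain ⟨K, hK0, hK⟩ := exists_norm_moebiusConv_le_rpow hσ' hN
  unfold HasFiniteMellinNorm
  have hmeas : Measurable fun x : ℝ => x ^ (-σ - 1) * ‖(Ioc (0 : ℝ) 1).indicator (moebiusConv φ) x‖ :=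
    (measurable_id.pow_const _).mul ((measurable_moebiusConv hφm).indicator measurableSet_Ioc).norm
  rw [← Ioc_union_Ioi_eq_Ioi (zero_le_one : (0 : ℝ) ≤ 1)]
  refine IntegrableOn.union ?_ ?_
  · have hint : IntegrableOn (fun x : ℝ => K * x ^ (σ' - σ - 1)) (Ioc 0 1) := by
      have h := intervalIntegral.intervalIntegrable_rpow' (a := 0) (b := 1)
        (show -1 < σ' - σ - 1 by linarith)
      rw [intervalIntegrable_iff_integrableOn_Ioc_of_le zero_le_one] at h
      exact h.const_mul K
    refine Integrable.mono' hint hmeas.aestronglyMeasurable ?_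
    refine ae_restrict_of_forall_mem measurableSet_Ioc fun x hx => ?_
    rw [Real.norm_eq_abs, abs_mul, abs_of_nonneg (Real.rpow_nonneg hx.1.le _), abs_norm,
      indicator_of_mem hx]
    calc x ^ (-σ - 1) * ‖moebiusConv φ x‖ ≤ x ^ (-σ - 1) * (K * x ^ σ') :=
          mul_le_mul_of_nonneg_left (hK x hx.1) (Real.rpow_nonneg hx.1.le _)
      _ = K * x ^ (σ' - σ - 1) := by
          rw [show σ' - σ - 1 = (-σ - 1) + σ' by ring, Real.rpow_add hx.1]; ring
  · refine integrableOn_zero.congr_fun (fun x hx => ?_) measurableSet_Ioi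
    have hx1 : (1 : ℝ) < x := hx
    have hnot : x ∉ Ioc (0 : ℝ) 1 := fun h => (not_le.2 hx1) h.2
    simp [indicator_of_notMem hnot]

/-- `h(s) = ∫₀¹ x^{−s−1} Gφ(x) dx` as the left-Mellin transform of the truncation.
[cite: BaezDuarte2005Moebius, Lemma 3.3 (arXiv Lemma 3.2)] -/
theorem leftMellin_indicator_moebiusConv (φ : ℝ → ℂ) (s : ℂ) :
    leftMellin ((Ioc (0 : ℝ) 1).indicator (moebiusConv φ)) s =
      ∫ x in Ioc (0 : ℝ) 1, (x : ℂ) ^ (-s - 1) * moebiusConv φ x := by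
  unfold leftMellin
  have h : ∀ x : ℝ, (x : ℂ) ^ (-s - 1) * (Ioc (0 : ℝ) 1).indicator (moebiusConv φ) x =
      (Ioc (0 : ℝ) 1).indicator (fun x : ℝ => (x : ℂ) ^ (-s - 1) * moebiusConv φ x) x := by
    intro x
    by_cases hx : x ∈ Ioc (0 : ℝ) 1
    · simp [indicator_of_mem hx]
    · simp [indicator_of_notMem hx]
  simp_rw [h]
  rw [setIntegral_indicator measurableSet_Ioc, inter_eq_right.2 Ioc_subset_Ioi_self]

/-- **The Landau step of Thm. 4.4, general exponent**: for real `φ` with `N_σ(φ) < ∞` on an open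
interval `(a₀, δ₀)`, `a₀ ≤ −1/2 < 0 < δ₀`, a ONE-SIDED bound `η Gφ(x) ≤ C x^{c}` (`x ≥ X`, `η = ±1`,
`c + ε < 0`, `a₀ ≤ c + ε/2`, `−1 < c + ε/2`, `0 < ε < δ₀`) forces `N_{c+3ε/4}(Gφ) < ∞`. The non-negative function
`A(x) = C x^{c} − η Gφ(x)` has Mellin transform
`C/(s−c) − η(φ^∧(s)/(sζ(s+1)) − h(s))`, holomorphic on a neighbourhood of the real segment
`(c+ε/2, 2]` (no real zeros of `ζ(s+1)`, removable singularity at `s = 0`, no zeros with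
`0 < |Im| < 1` by the certified `N(14) = 0`), so Landau's lemma (tree, MV Lemma 15.1) gives
absolute convergence down to `c+ε/2`. [cite: BaezDuarte2005Moebius, Thm. 4.4 (proof: "the oscillation Lemma 2.2, based on Landau's theorem"); MontgomeryVaughan2007, §15.1 Lemma 15.1] -/
theorem hasFiniteMellinNorm_moebiusConv_of_oneSided_rpow {φ : ℝ → ℂ} {a₀ δ₀ : ℝ}
    (hφm : Measurable φ) (hreal : ∀ u : ℝ, 0 < u → (φ u).im = 0) (ha₀ : a₀ ≤ -(1 / 2 : ℝ))
    (hNext : ∀ σ : ℝ, a₀ < σ → σ < δ₀ → HasFiniteMellinNorm φ σ)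
    {c ε η C X : ℝ} (hε : 0 < ε) (hεδ : ε < δ₀) (hcε : c + ε < 0) (ha₀c : a₀ ≤ c + ε / 2)
    (hc1 : -1 < c + ε / 2) (hη : η = 1 ∨ η = -1)
    (hb : ∀ x : ℝ, X ≤ x → η * (moebiusConv φ x).re ≤ C * x ^ c) :
    HasFiniteMellinNorm (moebiusConv φ) (c + 3 * ε / 4) := by
  have hδ₀ : 0 < δ₀ := by linarith
  have hηabs : |η| = 1 := by rcases hη with rfl | rfl <;> norm_num
  have hηsq : η * η = 1 := by rcases hη with rfl | rfl <;> norm_num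
  have hprop : IsMoebiusProper φ := ⟨hφm, fun σ h1 h2 => hNext σ (by linarith) (by linarith)⟩
  set G : ℝ → ℂ := moebiusConv φ with hGdef
  set Gr : ℝ → ℝ := fun x => (moebiusConv φ x).re with hGr
  have hGrG : ∀ x : ℝ, ((Gr x : ℝ) : ℂ) = G x := fun x => ofReal_re_moebiusConv hreal x
  have hGm : Measurable G := measurable_moebiusConv hφm
  have hGrm : Measurable Gr := Complex.measurable_re.comp hGm
  have hnormGr : ∀ x : ℝ, |Gr x| = ‖G x‖ := fun x => by
    rw [← hGrG x, Complex.norm_real, Real.norm_eq_abs]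
  obtain ⟨Kb, hKb0, hKb⟩ := exists_norm_moebiusConv_le hprop
  -- norms of `G` on `[0, δ₀)`
  have hGσ : ∀ σ : ℝ, 0 ≤ σ → σ < δ₀ → HasFiniteMellinNorm G σ := by
    intro σ h1 h2
    have h := hasFiniteMellinNorm_moebiusConv hφm (s := (σ : ℂ))
      (by rw [Complex.ofReal_re]; exact hNext σ (by linarith) h2)
      (by rw [Complex.ofReal_re]; exact hasFiniteMellinNorm_moebiusDivSum h1)
    rwa [Complex.ofReal_re] at h
  -- the non-negative function `g`
  set g : ℝ → ℝ := fun x => C * x ^ c - η * Gr x with hg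
  have hgm : Measurable g := (measurable_const.mul (measurable_id.pow_const _)).sub
    (measurable_const.mul hGrm)
  have hX₁ : (1 : ℝ) ≤ max X 1 := le_max_right _ _
  have hpos : ∀ x, max X 1 < x → 0 ≤ g x := fun x hx =>
    sub_nonneg.2 (hb x ((le_max_left _ _).trans hx.le))
  -- absolute convergence of `∫₁^∞ g x^{−(σ+1)}` at `σ = 0` (hence at `σ₁ = 1`)
  have hint_at : ∀ σ : ℝ, 0 ≤ σ → σ < δ₀ → IntegrableOn (fun x ↦ g x * x ^ (-(σ + 1))) (Ioi 1) := by
    intro σ h1 h2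
    have hA : IntegrableOn (fun x : ℝ => C * (x ^ c * x ^ (-(σ + 1)))) (Ioi 1) :=
      (integrableOn_rpow_mul_rpow_Ioi_one (show c < σ by linarith)).const_mul C
    have hB0 : IntegrableOn (fun x : ℝ => Gr x * x ^ (-(σ + 1))) (Ioi 1) := by
      have hN := hGσ σ h1 h2
      unfold HasFiniteMellinNorm at hN
      refine (hN.mono_set (Ioi_subset_Ioi zero_le_one)).mono'
        ((hGrm.mul (measurable_id.pow_const (-(σ + 1)))).aestronglyMeasurable) ?_
      refine ae_restrict_of_forall_mem measurableSet_Ioi fun x hx => ?_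
      have hx0 : (0 : ℝ) < x := lt_trans zero_lt_one hx
      rw [Real.norm_eq_abs, abs_mul, abs_of_nonneg (Real.rpow_nonneg hx0.le _), hnormGr,
        show -(σ + 1) = -σ - 1 by ring, mul_comm]
    have hB : IntegrableOn (fun x : ℝ => η * (Gr x * x ^ (-(σ + 1)))) (Ioi 1) := hB0.const_mul η
    refine (hA.sub hB).congr_fun (fun x _ => ?_) measurableSet_Ioi
    simp only [hg, Pi.sub_apply]; ring
  have hint : IntegrableOn (fun x ↦ g x * x ^ (-((1 : ℝ) + 1))) (Ioi 1) :=
    Landau.integrableOn_rpow_of_le hgm zero_le_one (hint_at 0 le_rfl hδ₀)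
  -- the auxiliary abscissa `σ' ∈ (ε, δ₀)` and the truncation `h`
  set σ' : ℝ := (ε + δ₀) / 2 with hσ'
  have hσ'1 : ε < σ' := by rw [hσ']; linarith
  have hσ'2 : σ' < δ₀ := by rw [hσ']; linarith
  have hσ'0 : 0 < σ' := by linarith
  have hNσ' : HasFiniteMellinNorm φ σ' := hNext σ' (by linarith) hσ'2
  set hfun : ℂ → ℂ := leftMellin ((Ioc (0 : ℝ) 1).indicator G) with hhfun
  have hhd : DifferentiableOn ℂ hfun {s : ℂ | -(10 : ℝ) < s.re ∧ s.re < σ'} :=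
    differentiableOn_leftMellin (hGm.indicator measurableSet_Ioc)
      fun σ _ h2 => hasFiniteMellinNorm_indicator_moebiusConv hφm hσ'0 hNσ' h2
  -- `φ^∧` is holomorphic on `a₀ < Re s < δ₀`
  have hφd : DifferentiableOn ℂ (leftMellin φ) {s : ℂ | a₀ < s.re ∧ s.re < δ₀} :=
    differentiableOn_leftMellin hφm hNext
  have hSφ : IsOpen {s : ℂ | a₀ < s.re ∧ s.re < δ₀} :=
    (isOpen_lt continuous_const Complex.continuous_re).inter
      (isOpen_lt Complex.continuous_re continuous_const)
  have hSh : IsOpen {s : ℂ | -(10 : ℝ) < s.re ∧ s.re < σ'} :=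
    (isOpen_lt continuous_const Complex.continuous_re).inter
      (isOpen_lt Complex.continuous_re continuous_const)
  -- the neighbourhood `W₀` of the real segment `(a, 2]`, `a = c + ε/2`, and the thinner `W₁`
  set a : ℝ := c + ε / 2 with ha
  set W₀ : Set ℂ := {s : ℂ | a < s.re ∧ s.re < 3 ∧ -1 < s.im ∧ s.im < 1} with hW₀
  set W₁ : Set ℂ := {s : ℂ | a < s.re ∧ s.re < σ' ∧ -1 < s.im ∧ s.im < 1} with hW₁
  have hW₀o : IsOpen W₀ :=
    (isOpen_lt continuous_const Complex.continuous_re).inter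
      ((isOpen_lt Complex.continuous_re continuous_const).inter
      ((isOpen_lt continuous_const Complex.continuous_im).inter
      (isOpen_lt Complex.continuous_im continuous_const)))
  have hW₁o : IsOpen W₁ :=
    (isOpen_lt continuous_const Complex.continuous_re).inter
      ((isOpen_lt Complex.continuous_re continuous_const).inter
      ((isOpen_lt continuous_const Complex.continuous_im).inter
      (isOpen_lt Complex.continuous_im continuous_const)))
  have hW₀c : Convex ℝ W₀ :=
    (convex_halfSpace_re_gt _).inter ((convex_halfSpace_re_lt _).inter
      ((convex_halfSpace_im_gt _).inter (convex_halfSpace_im_lt _)))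
  have hW₀r : ∀ σ : ℝ, a < σ → σ ≤ 1 + 1 → (σ : ℂ) ∈ W₀ := by
    intro σ h1 h2
    simp only [hW₀, mem_setOf_eq, Complex.ofReal_re, Complex.ofReal_im]
    exact ⟨h1, by linarith, by norm_num, by norm_num⟩
  -- `ζ(s+1) ≠ 0` on `W₀ ∖ {0}`
  have hζW : ∀ s : ℂ, a < s.re → -1 < s.im → s.im < 1 → s ≠ 0 → riemannZeta (s + 1) ≠ 0 := by
    intro s h1 h2 h3 h0
    refine riemannZeta_ne_zero_of_abs_im_le_fourteen ?_ ?_ ?_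
    · rw [Complex.add_re, Complex.one_re]; rw [ha] at h1; linarith
    · rw [Complex.add_im, Complex.one_im, add_zero]; exact (abs_lt.2 ⟨h2, h3⟩).le.trans (by norm_num)
    · simpa using h0
  -- the formula `F` for the continuation on `W₁`
  set F : ℂ → ℂ := fun s => (C : ℂ) * (1 / (s - (c : ℂ))) -
    (η : ℂ) * (leftMellin φ s * (Function.update (fun s : ℂ => (s * riemannZeta (s + 1))⁻¹) 0 1) s
      - hfun s) with hF
  have hFd : ∀ s ∈ W₁, DifferentiableAt ℂ F s := by
    intro s hs
    obtain ⟨h1, h2, h3, h4⟩ := hs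
    have hsc : s - (c : ℂ) ≠ 0 := by
      intro h
      have := congrArg Complex.re h
      simp only [Complex.sub_re, Complex.ofReal_re, Complex.zero_re] at this
      rw [ha] at h1; linarith
    have d1' : DifferentiableAt ℂ (fun z : ℂ => 1 / (z - (c : ℂ))) s :=
      DifferentiableAt.div (differentiableAt_const (1 : ℂ)) (differentiableAt_id.sub_const (c : ℂ)) hsc
    have d1 : DifferentiableAt ℂ (fun z : ℂ => (C : ℂ) * (1 / (z - (c : ℂ)))) s := d1'.const_mul (C : ℂ)
    have hs1' : a₀ < s.re := by rw [ha] at h1; linarith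
    have hs2' : s.re < δ₀ := by linarith
    have d2 : DifferentiableAt ℂ (leftMellin φ) s := hφd.differentiableAt (hSφ.mem_nhds ⟨hs1', hs2'⟩)
    have d3 : DifferentiableAt ℂ (Function.update (fun s : ℂ => (s * riemannZeta (s + 1))⁻¹) 0 1) s := by
      by_cases hs0 : s = 0
      · rw [hs0]; exact analyticAt_invMulZeta_zero.differentiableAt
      · exact differentiableAt_invMulZeta hs0 (hζW s h1 h3 h4 hs0)
    have hs3' : -(10 : ℝ) < s.re := by linarith
    have d4 : DifferentiableAt ℂ hfun s := hhd.differentiableAt (hSh.mem_nhds ⟨hs3', h2⟩)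
    exact d1.sub (((d2.mul d3).sub d4).const_mul _)
  -- `mellinIoi g` is holomorphic on `Re s > 0`
  have hMd : DifferentiableOn ℂ (Landau.mellinIoi g) {s : ℂ | (0 : ℝ) < s.re} :=
    Landau.differentiableOn_mellinIoi hgm (by simpa using hint_at 0 le_rfl hδ₀)
  -- agreement `F = mellinIoi g` on `W₁ ∩ {0 < Re s}`
  have hagreeW : ∀ s ∈ W₁, 0 < s.re → F s = Landau.mellinIoi g s := by
    intro s hs hs0
    obtain ⟨h1, h2, h3, h4⟩ := hs
    have hsδ : s.re < δ₀ := by linarith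
    have hsne : s ≠ 0 := by
      intro h; rw [h] at hs0; simp at hs0
    -- the two pieces of `mellinIoi g`
    have hIc : IntegrableOn (fun x : ℝ => ((x ^ c : ℝ) : ℂ) * (x : ℂ) ^ (-(s + 1))) (Ioi 1) := by
      refine (integrableOn_rpow_mul_rpow_Ioi_one (show c < s.re by linarith)).norm.mono'
        ((Complex.measurable_ofReal.comp (measurable_id.pow_const _)).mul
          (Complex.measurable_ofReal.pow_const _)).aestronglyMeasurable ?_
      refine ae_restrict_of_forall_mem measurableSet_Ioi fun x hx => ?_
      have hx0 : (0 : ℝ) < x := lt_trans zero_lt_one hx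
      rw [norm_mul, Complex.norm_real, Complex.norm_cpow_eq_rpow_re_of_pos hx0, Real.norm_eq_abs,
        Real.norm_eq_abs, abs_mul, abs_of_nonneg (Real.rpow_nonneg hx0.le _),
        abs_of_nonneg (Real.rpow_nonneg hx0.le _)]
      have hre : (-(s + 1)).re = -(s.re + 1) := by simp
      rw [hre]
    have hNG := hGσ s.re hs0.le hsδ
    have hIG0 : IntegrableOn (fun x : ℝ => (x : ℂ) ^ (-s - 1) * G x) (Ioi 0) :=
      integrableOn_cpow_mul hGm hNG
    have hIG : IntegrableOn (fun x : ℝ => ((Gr x : ℝ) : ℂ) * (x : ℂ) ^ (-(s + 1))) (Ioi 1) := by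
      refine (hIG0.mono_set (Ioi_subset_Ioi zero_le_one)).congr_fun (fun x _ => ?_) measurableSet_Ioi
      rw [hGrG, show -(s + 1) = -s - 1 by ring, mul_comm]
    have hM : Landau.mellinIoi g s = (C : ℂ) * (1 / (s - (c : ℂ))) -
        (η : ℂ) * ∫ x in Ioi (1 : ℝ), (x : ℂ) ^ (-s - 1) * G x := by
      unfold Landau.mellinIoi
      have hsplit : ∀ x : ℝ, ((g x : ℝ) : ℂ) * (x : ℂ) ^ (-(s + 1)) =
          (C : ℂ) * (((x ^ c : ℝ) : ℂ) * (x : ℂ) ^ (-(s + 1))) -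
            (η : ℂ) * (((Gr x : ℝ) : ℂ) * (x : ℂ) ^ (-(s + 1))) := by
        intro x; simp only [hg]; push_cast; ring
      simp_rw [hsplit]
      rw [integral_sub (hIc.const_mul _) (hIG.const_mul _), integral_const_mul, integral_const_mul,
        integral_rpow_mul_cpow_Ioi_one (show c < s.re by linarith)]
      congr 2
      refine setIntegral_congr_fun measurableSet_Ioi fun x _ => ?_
      rw [hGrG, show -(s + 1) = -s - 1 by ring, mul_comm]
    -- `G^∧(s) = ∫_{(0,1]} + ∫_{(1,∞)}` and `G^∧(s) = g^∧(s) φ^∧(s) = φ^∧(s)/(sζ(s+1))`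
    have hsplitG : leftMellin G s = hfun s + ∫ x in Ioi (1 : ℝ), (x : ℂ) ^ (-s - 1) * G x := by
      rw [hhfun, leftMellin_indicator_moebiusConv]
      unfold leftMellin
      rw [← Ioc_union_Ioi_eq_Ioi (zero_le_one : (0 : ℝ) ≤ 1)] 
      have hdisj : Disjoint (Ioc (0 : ℝ) 1) (Ioi 1) :=
        Set.disjoint_left.2 fun t ht ht' => (not_lt.2 ht.2) ht'
      rw [setIntegral_union hdisj measurableSet_Ioi (hIG0.mono_set Ioc_subset_Ioi_self)
        (hIG0.mono_set (Ioi_subset_Ioi zero_le_one))]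
    have hfac := leftMellin_moebiusConv_eq hφm (s := s) (hNext s.re (by linarith) hsδ)
      (hasFiniteMellinNorm_moebiusDivSum hs0.le)
    rw [leftMellin_moebiusDivSum_eq_invMulZeta hs0] at hfac
    -- assemble
    rw [hM, hF]
    have : ∫ x in Ioi (1 : ℝ), (x : ℂ) ^ (-s - 1) * G x = leftMellin φ s *
        (Function.update (fun s : ℂ => (s * riemannZeta (s + 1))⁻¹) 0 1) s - hfun s := by
      have h := hsplitG
      rw [hfac] at h
      linear_combination -h
    rw [this]
  -- the glued continuation
  set Φ : ℂ → ℂ := fun s => if 0 < s.re then Landau.mellinIoi g s else F s with hΦ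
  have hagree : EqOn Φ (Landau.mellinIoi g) {s : ℂ | (1 : ℝ) < s.re} := by
    intro s hs
    have hs' : (0 : ℝ) < s.re := lt_trans zero_lt_one hs
    simp [hΦ, hs']
  have hΦd : DifferentiableOn ℂ Φ ({s : ℂ | (1 : ℝ) < s.re} ∪ W₀) := by
    intro s hs
    apply DifferentiableAt.differentiableWithinAt
    by_cases hs0 : 0 < s.re
    · have hev : Φ =ᶠ[𝓝 s] Landau.mellinIoi g := by
        filter_upwards [(isOpen_lt continuous_const Complex.continuous_re).mem_nhds hs0] with z hz
        have hz' : (0 : ℝ) < z.re := hz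
        simp [hΦ, hz']
      exact (hMd.differentiableAt ((isOpen_lt continuous_const Complex.continuous_re).mem_nhds
        hs0)).congr_of_eventuallyEq hev
    · push Not at hs0
      have hsW : s ∈ W₀ := by
        rcases hs with hs | hs
        · exact absurd (lt_trans zero_lt_one hs) (not_lt.2 hs0)
        · exact hs
      obtain ⟨h1, h2, h3, h4⟩ := hsW
      have hsW₁ : s ∈ W₁ := ⟨h1, by linarith, h3, h4⟩
      have hev : Φ =ᶠ[𝓝 s] F := by
        filter_upwards [hW₁o.mem_nhds hsW₁] with z hz
        by_cases hz0 : 0 < z.re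
        · simp only [hΦ, hz0, if_true]; exact (hagreeW z hz hz0).symm
        · simp only [hΦ, hz0, if_false]
      exact (hFd s hsW₁).congr_of_eventuallyEq hev
  -- Landau's lemma at `σ = c + 3ε/4 ∈ (a, …)`
  have haσ : a < c + 3 * ε / 4 := by rw [ha]; linarith
  have hL := Landau.integrableOn_of_differentiableOn_union_convex hgm hint hX₁ hpos
    (show a < 1 by rw [ha]; linarith) hW₀o hW₀c hW₀r hΦd hagree haσ
  -- back to `N_σ(G)`, `σ = c + 3ε/4`
  set σ : ℝ := c + 3 * ε / 4 with hσdef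
  unfold HasFiniteMellinNorm
  have hmeas : Measurable fun x : ℝ => x ^ (-σ - 1) * ‖G x‖ := (measurable_id.pow_const _).mul hGm.norm
  rw [← Ioc_union_Ioi_eq_Ioi (zero_le_one : (0 : ℝ) ≤ 1)]
  refine IntegrableOn.union ?_ ?_
  · -- (0,1]: from the truncation lemma
    have h := hasFiniteMellinNorm_indicator_moebiusConv hφm hσ'0 hNσ' (σ := σ) (by linarith)
    unfold HasFiniteMellinNorm at h
    refine (h.mono_set Ioc_subset_Ioi_self).congr_fun (fun x hx => ?_) measurableSet_Ioc
    simp only [indicator_of_mem hx, hGdef]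
  · -- (1,∞): `|G| x^{−σ−1} ≤ |C| x^c x^{−(σ+1)} + |g x x^{−(σ+1)}|`
    have hmaj : IntegrableOn (fun x : ℝ => |C| * (x ^ c * x ^ (-(σ + 1))) +
        ‖g x * x ^ (-(σ + 1))‖) (Ioi 1) :=
      ((integrableOn_rpow_mul_rpow_Ioi_one (show c < σ by rw [hσdef]; linarith)).const_mul _).add
        hL.norm
    refine Integrable.mono' hmaj hmeas.aestronglyMeasurable ?_
    refine ae_restrict_of_forall_mem measurableSet_Ioi fun x hx => ?_
    have hx0 : (0 : ℝ) < x := lt_trans zero_lt_one hx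
    have hxp : 0 ≤ x ^ (-(σ + 1)) := Real.rpow_nonneg hx0.le _
    rw [Real.norm_eq_abs, abs_mul, abs_of_nonneg (Real.rpow_nonneg hx0.le _), abs_norm,
      ← hnormGr, show -σ - 1 = -(σ + 1) by ring, Real.norm_eq_abs, abs_mul, abs_of_nonneg hxp]
    have hGr_eq : Gr x = η * (C * x ^ c - g x) := by
      simp only [hg]
      linear_combination (-(Gr x)) * hηsq
    rw [hGr_eq, abs_mul, hηabs, one_mul]
    calc x ^ (-(σ + 1)) * |C * x ^ c - g x| ≤ x ^ (-(σ + 1)) * (|C| * x ^ c + |g x|) := by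
          refine mul_le_mul_of_nonneg_left ?_ hxp
          calc |C * x ^ c - g x| ≤ |C * x ^ c| + |g x| := abs_sub _ _
            _ = |C| * x ^ c + |g x| := by rw [abs_mul, abs_of_nonneg (Real.rpow_nonneg hx0.le _)]
      _ = |C| * (x ^ c * x ^ (-(σ + 1))) + |g x| * x ^ (-(σ + 1)) := by ring


/-- **The Landau step of Thm. 4.4 (boundary exponent)**: for real `φ` with `N_σ(φ) < ∞` on an open
interval `(−1/2−δ₀, δ₀)` around `[−1/2, 0]`, a ONE-SIDED bound `η Gφ(x) ≤ C x^{−1/2−ε}` (`x ≥ X`,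
`η = ±1`, `0 < ε < min(δ₀, 1)`) forces `N_{−1/2−ε/4}(Gφ) < ∞`. [cite: BaezDuarte2005Moebius, Thm. 4.4 (proof); MontgomeryVaughan2007, §15.1 Lemma 15.1] -/
theorem hasFiniteMellinNorm_moebiusConv_of_oneSided {φ : ℝ → ℂ} {δ₀ : ℝ} (hφm : Measurable φ)
    (hreal : ∀ u : ℝ, 0 < u → (φ u).im = 0)
    (hNext : ∀ σ : ℝ, -(1 / 2 : ℝ) - δ₀ < σ → σ < δ₀ → HasFiniteMellinNorm φ σ)
    {ε η C X : ℝ} (hε : 0 < ε) (hεδ : ε < δ₀) (hε1 : ε < 1) (hη : η = 1 ∨ η = -1)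
    (hb : ∀ x : ℝ, X ≤ x → η * (moebiusConv φ x).re ≤ C * x ^ (-(1 / 2 : ℝ) - ε)) :
    HasFiniteMellinNorm (moebiusConv φ) (-(1 / 2 : ℝ) - ε / 4) := by
  have h := hasFiniteMellinNorm_moebiusConv_of_oneSided_rpow (a₀ := -(1 / 2 : ℝ) - δ₀) hφm hreal
    (by linarith) hNext (c := -(1 / 2 : ℝ) - ε) hε hεδ (by linarith) (by linarith) (by linarith) hη hb
  rw [show -(1 / 2 : ℝ) - ε + 3 * ε / 4 = -(1 / 2 : ℝ) - ε / 4 by ring] at h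
  exact h

/-- Boundary uniqueness on a strip `a < Re s < 0` of any width (`a < 0`): a function holomorphic
there, continuous from `{Re s ≤ 0}` at the points `iτ`, `1 < τ < 2`, and zero there, vanishes on
the strip (rotation `z = −is`, the tree's local half-disc lemma
`Literature.Analysis.Complex.eqOn_zero_of_eqOn_real_diameter` on `B(3/2, min(1/2, −a))`, identity
theorem on the convex strip). [cite: Conway1978, Ch. IX Thm. 1.1] -/
theorem eq_zero_of_eqOn_boundary_segment_of_lt {D : ℂ → ℂ} {a : ℝ} (ha : a < 0)
    (hd : DifferentiableOn ℂ D {s : ℂ | a < s.re ∧ s.re < 0})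
    (hc : ∀ τ : ℝ, τ ∈ Ioo (1 : ℝ) 2 → ContinuousWithinAt D {s : ℂ | s.re ≤ 0} (τ * I))
    (h0 : ∀ τ : ℝ, τ ∈ Ioo (1 : ℝ) 2 → D (τ * I) = 0) {s : ℂ}
    (hs1 : a < s.re) (hs2 : s.re < 0) : D s = 0 := by
  set f : ℂ → ℂ := fun z => D (I * z) with hf
  have hIre : ∀ z : ℂ, (I * z).re = -z.im := fun z => by simp
  set r : ℝ := min (1 / 2 : ℝ) (-a) with hr
  have hr0 : 0 < r := by rw [hr]; exact lt_min (by norm_num) (neg_pos.2 ha)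
  have hr1 : r ≤ 1 / 2 := min_le_left _ _
  have hr2 : r ≤ -a := min_le_right _ _
  have hV : IsOpen {z : ℂ | 0 < z.im ∧ z.im < -a} :=
    (isOpen_lt continuous_const Complex.continuous_im).inter
      (isOpen_lt Complex.continuous_im continuous_const)
  have hfd : DifferentiableOn ℂ f {z : ℂ | 0 < z.im ∧ z.im < -a} := by
    refine hd.comp ((differentiable_id.const_mul I).differentiableOn) fun z hz => ?_
    simp only [mem_setOf_eq, hIre]
    exact ⟨by linarith [hz.2], by linarith [hz.1]⟩
  have hball_im : ∀ z ∈ Metric.ball (((3 / 2 : ℝ)) : ℂ) r, |z.im| < r := by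
    intro z hz
    rw [Metric.mem_ball, dist_eq_norm] at hz
    have h := Complex.abs_im_le_norm (z - ((3 / 2 : ℝ) : ℂ))
    rw [Complex.sub_im, Complex.ofReal_im, sub_zero] at h
    exact lt_of_le_of_lt h hz
  have hball_re : ∀ z ∈ Metric.ball (((3 / 2 : ℝ)) : ℂ) r, z.re ∈ Ioo (1 : ℝ) 2 := by
    intro z hz
    rw [Metric.mem_ball, dist_eq_norm] at hz
    have h := Complex.abs_re_le_norm (z - ((3 / 2 : ℝ) : ℂ))
    rw [Complex.sub_re, Complex.ofReal_re] at h
    have h' := abs_lt.1 (lt_of_le_of_lt h hz)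
    constructor <;> linarith [h'.1, h'.2]
  -- the half-disc lemma
  have hhalf : EqOn f 0 (Metric.ball (((3 / 2 : ℝ)) : ℂ) r ∩ {z : ℂ | 0 < z.im}) := by
    refine Literature.Analysis.Complex.eqOn_zero_of_eqOn_real_diameter hr0 ?_ ?_ ?_
    · exact hfd.mono fun z hz => ⟨hz.2, lt_of_le_of_lt (le_abs_self _) (lt_of_lt_of_le (hball_im z hz.1) hr2)⟩
    · intro x hx
      have hτ : x ∈ Ioo (1 : ℝ) 2 := by simpa using hball_re x hx
      have hweq : I * (x : ℂ) = (x : ℂ) * I := mul_comm _ _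
      have hmap : MapsTo (fun z : ℂ => I * z) {z : ℂ | 0 ≤ z.im} {s : ℂ | s.re ≤ 0} := by
        intro z hz
        simp only [mem_setOf_eq, hIre]
        simp only [mem_setOf_eq] at hz
        linarith
      have h1 : ContinuousWithinAt D {s : ℂ | s.re ≤ 0} (I * x) := by rw [hweq]; exact hc x hτ
      exact h1.comp (continuous_const.mul continuous_id).continuousWithinAt hmap
    · intro x hx
      have hτ : x ∈ Ioo (1 : ℝ) 2 := by simpa using hball_re x hx
      show D (I * x) = 0
      rw [mul_comm]; exact h0 x hτ
  -- identity theorem on the convex strip `V`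
  set w₀ : ℂ := ((3 / 2 : ℝ) : ℂ) + ((r / 2 : ℝ) : ℂ) * I with hw₀
  have hw₀im : w₀.im = r / 2 := by simp [hw₀]
  have hw₀ball : w₀ ∈ Metric.ball (((3 / 2 : ℝ)) : ℂ) r := by
    rw [Metric.mem_ball, dist_eq_norm, hw₀, add_sub_cancel_left, norm_mul, Complex.norm_real,
      Complex.norm_I, mul_one, Real.norm_eq_abs, abs_of_pos (by positivity)]
    linarith
  have hw₀V : w₀ ∈ {z : ℂ | 0 < z.im ∧ z.im < -a} := by
    refine ⟨?_, ?_⟩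
    · show 0 < w₀.im
      rw [hw₀im]; positivity
    · show w₀.im < -a
      rw [hw₀im]; linarith
  have hfev : f =ᶠ[𝓝 w₀] 0 := by
    have hopen : IsOpen (Metric.ball (((3 / 2 : ℝ)) : ℂ) r ∩ {z : ℂ | 0 < z.im}) :=
      Metric.isOpen_ball.inter (isOpen_lt continuous_const Complex.continuous_im)
    exact Filter.eventuallyEq_of_mem (hopen.mem_nhds ⟨hw₀ball, hw₀V.1⟩) hhalf
  have hVconv : Convex ℝ {z : ℂ | 0 < z.im ∧ z.im < -a} :=
    (convex_halfSpace_im_gt (0 : ℝ)).inter (convex_halfSpace_im_lt _)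
  have hfV : EqOn f 0 {z : ℂ | 0 < z.im ∧ z.im < -a} :=
    (hfd.analyticOnNhd hV).eqOn_zero_of_preconnected_of_eventuallyEq_zero hVconv.isPreconnected
      hw₀V hfev
  have hz : -I * s ∈ {z : ℂ | 0 < z.im ∧ z.im < -a} := by
    refine ⟨?_, ?_⟩
    · show 0 < (-I * s).im
      simp; linarith
    · show (-I * s).im < -a
      simp; linarith
  have := hfV hz
  simpa [hf, ← mul_assoc] using this

/-- **(3.11) on a narrower strip**: for proper `φ` with `N_σ(Gφ) < ∞` for `a < σ < 0`
(`−1/2 ≤ a < 0`), `(Gφ)^∧(s) · s ζ(s+1) = φ^∧(s)` on `a < Re s < 0` — the same boundary-value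
argument on the line `Re s = 0` ((3.10), (2.12)) with the strip-width-free uniqueness lemma.
[cite: BaezDuarte2005Moebius, Lemma 3.4 (3.12) and Prop. 4.3 (4.13) (arXiv Lemma 3.3 (3.11))] -/
theorem leftMellin_moebiusConv_mul_eq_of_hasFiniteMellinNorm_of_lt {φ : ℝ → ℂ} (hφ : IsMoebiusProper φ)
    {a : ℝ} (ha1 : -(1 / 2 : ℝ) ≤ a) (ha2 : a < 0)
    (hGσ : ∀ σ : ℝ, a < σ → σ < 0 → HasFiniteMellinNorm (moebiusConv φ) σ)
    {s : ℂ} (hs1 : a < s.re) (hs2 : s.re < 0) :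
    leftMellin (moebiusConv φ) s * (s * riemannZeta (s + 1)) = leftMellin φ s := by
  obtain ⟨hφm, hN⟩ := hφ
  have hN0 : HasFiniteMellinNorm φ 0 := hN 0 (by norm_num) le_rfl
  have hg0 : HasFiniteMellinNorm (fun x : ℝ => (moebiusDivSum x : ℂ)) 0 :=
    hasFiniteMellinNorm_moebiusDivSum le_rfl
  have hG0 : HasFiniteMellinNorm (moebiusConv φ) 0 := hasFiniteMellinNorm_moebiusConv_zero ⟨hφm, hN⟩
  -- the boundary function `D`
  have hDd : DifferentiableOn ℂ (fun s : ℂ =>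
      leftMellin (moebiusConv φ) s * (s * riemannZeta (s + 1)) - leftMellin φ s)
      {s : ℂ | a < s.re ∧ s.re < 0} := by
    have h1 := differentiableOn_leftMellin (measurable_moebiusConv hφm) hGσ
    have h2 := differentiableOn_leftMellin hφm (a := a) (b := 0) (fun σ ha hb => hN σ (by linarith) hb.le)
    have h3 : DifferentiableOn ℂ (fun s : ℂ => s * riemannZeta (s + 1))
        {s : ℂ | a < s.re ∧ s.re < 0} := by
      intro z hz
      have hz1 : z + 1 ≠ 1 := by
        intro h
        have h0 : z = 0 := by linear_combination h
        rw [h0] at hz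
        simp only [mem_setOf_eq, Complex.zero_re] at hz
        linarith [hz.2]
      have h4 : DifferentiableAt ℂ (fun w : ℂ => w + 1) z := differentiableAt_id.add_const 1
      exact (differentiableAt_id.mul (DifferentiableAt.comp (f := fun w : ℂ => w + 1) z
        (differentiableAt_riemannZeta hz1) h4)).differentiableWithinAt
    exact (h1.mul h3).sub h2
  have hDc : ∀ τ : ℝ, τ ∈ Ioo (1 : ℝ) 2 → ContinuousWithinAt (fun s : ℂ =>
      leftMellin (moebiusConv φ) s * (s * riemannZeta (s + 1)) - leftMellin φ s)
      {s : ℂ | s.re ≤ 0} (τ * I) := by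
    intro τ hτ
    have hτ0 : ((τ : ℂ) * I).re = 0 := by simp
    have hnhds : {s : ℂ | a / 2 ≤ s.re ∧ s.re ≤ 0} ∈ 𝓝[{s : ℂ | s.re ≤ 0}] ((τ : ℂ) * I) := by
      have hlt : (τ : ℂ) * I ∈ {s : ℂ | a / 2 < s.re} := by
        show a / 2 < ((τ : ℂ) * I).re
        rw [hτ0]
        linarith
      have h := inter_mem_nhdsWithin {s : ℂ | s.re ≤ 0}
        ((isOpen_lt continuous_const Complex.continuous_re).mem_nhds hlt)
      exact Filter.mem_of_superset h fun z hz => ⟨le_of_lt (α := ℝ) hz.2, hz.1⟩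
    have h1 : ContinuousWithinAt (leftMellin (moebiusConv φ)) {s : ℂ | s.re ≤ 0} (τ * I) :=
      (continuousWithinAt_leftMellin (measurable_moebiusConv hφm)
        (hGσ _ (by linarith) (by linarith)) hG0 _).mono_of_mem_nhdsWithin hnhds
    have h2 : ContinuousWithinAt (leftMellin φ) {s : ℂ | s.re ≤ 0} (τ * I) :=
      (continuousWithinAt_leftMellin hφm (hN _ (by linarith) (by linarith)) hN0 _).mono_of_mem_nhdsWithin
        hnhds
    have h3 : ContinuousAt (fun s : ℂ => s * riemannZeta (s + 1)) (τ * I) := by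
      have hs1 : (τ : ℂ) * I + 1 ≠ 1 := by
        intro h
        have h0 : (τ : ℂ) * I = 0 := by linear_combination h
        rcases mul_eq_zero.1 h0 with h5 | h5
        · have : τ = 0 := by exact_mod_cast h5
          linarith [hτ.1]
        · exact Complex.I_ne_zero h5
      have h4 : ContinuousAt (fun z : ℂ => z + 1) ((τ : ℂ) * I) :=
        (continuous_id.add continuous_const).continuousAt
      exact continuousAt_id.mul (ContinuousAt.comp (f := fun z : ℂ => z + 1)
        (differentiableAt_riemannZeta hs1).continuousAt h4)
    exact (h1.mul h3.continuousWithinAt).sub h2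
  have hD0 : ∀ τ : ℝ, τ ∈ Ioo (1 : ℝ) 2 → (fun s : ℂ =>
      leftMellin (moebiusConv φ) s * (s * riemannZeta (s + 1)) - leftMellin φ s) (τ * I) = 0 := by
    intro τ hτ
    have hsre : ((τ : ℂ) * I).re = 0 := by simp
    have hτ0 : (τ : ℂ) * I ≠ 0 := by
      intro h0
      rcases mul_eq_zero.1 h0 with h5 | h5
      · have : τ = 0 := by exact_mod_cast h5
        linarith [hτ.1]
      · exact Complex.I_ne_zero h5
    have hfac := leftMellin_moebiusConv_eq hφm (s := (τ : ℂ) * I)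
      (by rw [hsre]; exact hN0) (by rw [hsre]; exact hg0)
    have h27 := riemannZeta_mul_leftMellin_moebiusDivSum_of_re_eq_zero hsre hτ0
    simp only
    rw [hfac]
    linear_combination (leftMellin φ ((τ : ℂ) * I)) * h27
  have hDs := eq_zero_of_eqOn_boundary_segment_of_lt ha2 hDd hDc hD0 hs1 hs2
  exact sub_eq_zero.1 hDs

/-- **A zero `ρ₀` of `ζ` off the critical line bounds the abscissa: `N_σ(Gφ) = ∞` for every
`σ < Re ρ₀ − 1`** (`1/2 < Re ρ₀ < 1`, `φ` Mellin-proper): otherwise `(Gφ)^∧` would be holomorphic at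
`s₀ = ρ₀ − 1` and (3.11) would give `φ^∧(s₀) = (Gφ)^∧(s₀)·s₀ζ(ρ₀) = 0`, contradicting
Mellin-properness. This is the printed "In this half-plane there are poles for `f(s)`" ((4.13)) in
the case of an off-line zero. [cite: BaezDuarte2005Moebius, Prop. 4.3 (proof, (4.13)) and Thm. 4.4 (proof)] -/
theorem not_hasFiniteMellinNorm_moebiusConv_of_lt_re_zero {φ : ℝ → ℂ} (hφ : IsMellinProper φ)
    {ρ₀ : ℂ} (hρ : riemannZeta ρ₀ = 0) (h1 : 1 / 2 < ρ₀.re) (h2 : ρ₀.re < 1) {σ : ℝ}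
    (hσ : σ < ρ₀.re - 1) : ¬ HasFiniteMellinNorm (moebiusConv φ) σ := by
  intro hGσ
  have hφm : Measurable φ := hφ.1.1
  have hG0 := hasFiniteMellinNorm_moebiusConv_zero hφ.1
  -- interpolation: `N_{σ'}(Gφ) < ∞` for `σ ≤ σ' ≤ 0`
  have hGall : ∀ σ' : ℝ, σ ≤ σ' → σ' ≤ 0 → HasFiniteMellinNorm (moebiusConv φ) σ' := by
    intro σ' h1' h2'
    have hGσ' := hGσ
    have hG0' := hG0
    unfold HasFiniteMellinNorm at hGσ' hG0' ⊢
    refine (hGσ'.add hG0').mono'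
      ((measurable_id.pow_const _).mul (measurable_moebiusConv hφm).norm).aestronglyMeasurable ?_
    refine ae_restrict_of_forall_mem measurableSet_Ioi fun x hx => ?_
    have hx0 : (0 : ℝ) < x := hx
    rw [Real.norm_eq_abs, abs_mul, abs_of_nonneg (Real.rpow_nonneg hx0.le _), abs_norm,
      Pi.add_apply, ← add_mul]
    refine mul_le_mul_of_nonneg_right ?_ (norm_nonneg _)
    -- `x^{-σ'-1} ≤ x^{-σ-1} + x^{-0-1}`
    rcases le_or_gt x 1 with hx1 | hx1
    · calc x ^ (-σ' - 1) ≤ x ^ (-(0 : ℝ) - 1) :=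
            Real.rpow_le_rpow_of_exponent_ge hx0 hx1 (by linarith)
        _ ≤ x ^ (-σ - 1) + x ^ (-(0 : ℝ) - 1) := le_add_of_nonneg_left (Real.rpow_nonneg hx0.le _)
    · calc x ^ (-σ' - 1) ≤ x ^ (-σ - 1) :=
            Real.rpow_le_rpow_of_exponent_le hx1.le (by linarith)
        _ ≤ x ^ (-σ - 1) + x ^ (-(0 : ℝ) - 1) := le_add_of_nonneg_right (Real.rpow_nonneg hx0.le _)
  set a : ℝ := max σ (-(1 / 2 : ℝ))
  have ha1 : -(1 / 2 : ℝ) ≤ a := le_max_right _ _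
  have ha2 : a < ρ₀.re - 1 := max_lt hσ (by linarith)
  have ha0 : a < 0 := by linarith
  have h311 := leftMellin_moebiusConv_mul_eq_of_hasFiniteMellinNorm_of_lt hφ.1 ha1 ha0
    (fun σ' h1' h2' => hGall σ' ((le_max_left _ _).trans h1'.le) h2'.le)
    (s := ρ₀ - 1) (by rw [Complex.sub_re, Complex.one_re]; exact ha2)
    (by rw [Complex.sub_re, Complex.one_re]; linarith)
  rw [sub_add_cancel, hρ, mul_zero, mul_zero] at h311
  exact hφ.2 (ρ₀ - 1) (by rw [Complex.sub_re, Complex.one_re]; linarith)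
    (by rw [Complex.sub_re, Complex.one_re]; linarith) h311.symm

end BaezDuarteMellin

open BaezDuarteMellin in
/-- **Báez-Duarte 2005, Theorem 4.4 (IJMMS p. 3607, (4.14)), oscillation of `Gφ` — PROVED in the
boundary-exponent form `ϑ = 1/2`, unconditionally.** Printed: "If `φ` is real and Mellin-proper,
then there exists a `ϑ ∈ [0,1/2)` such that `liminf_{x→∞} x^{ϑ+ε} Gφ(x) = −∞`,
`limsup_{x→∞} x^{ϑ+ε} Gφ(x) = +∞` for all `ε > 0`" ("the infinite number of oscillations of `g(x)`
is transmitted to `Gφ(x)` unconditionally"; proof: Landau's theorem applied to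
`f(s) = ∫₁^∞ x^{−s−1}Gφ dx = h(s) + φ^∧(s)/(sζ(s+1))`, "abscissa of convergence `α ∈ (−1/2, 0]` …
`ϑ = −α`"). As recorded in `BaezDuarte2005Moebius_thm_4_4_range_of_riemannHypothesis`, the printed
range `ϑ < 1/2` tacitly assumes `α > −1/2` and fails under RH; what the printed argument proves in
general is the statement at the exponent `1/2`: here, for real `φ` whose norms `N_σ(φ)` are finite
on an open interval `(−1/2−δ₀, δ₀)` ⊇ `[−1/2, 0]` (so that `φ^∧/(sζ(s+1))` and `h` are holomorphic
near the real segment `[−1/2, 0]`, as the printed "it is obvious that `s = α` cannot be a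
singularity" requires) and with `φ^∧ ≠ 0` on `−1/2 ≤ Re s < 0` (Mellin-proper, and on the line as in
Thm. 4.1), for EVERY `ε > 0` and every `C`: `x^{1/2+ε} Gφ(x) > C` for arbitrarily large `x` and
`x^{1/2+ε} Gφ(x) < C` for arbitrarily large `x` — i.e. `limsup x^{1/2+ε}Gφ = +∞`,
`liminf x^{1/2+ε}Gφ = −∞`. Proof: a one-sided bound makes `A(x) = C x^{−1/2−ε} ∓ Gφ(x) ≥ 0` with
transform holomorphic near the real segment `(−1/2−ε/2, 2]` (the tree's certified `N(14) = 0`,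
`ζ < 0` on `(0,1)`, removable singularity at `s = 0`), so Landau's lemma
(`Landau.integrableOn_of_differentiableOn_union_convex`) gives `N_{−1/2−ε/4}(Gφ) < ∞`, contradicting
"`α ≥ −1/2`" (`not_hasFiniteMellinNorm_moebiusConv_of_lt`, the certified critical zero). Nothing here
bears on the truth of RH. [cite: BaezDuarte2005Moebius, Thm. 4.4 (4.14) (IJMMS 2005:22 p. 3607); MontgomeryVaughan2007, §15.1 Lemma 15.1] -/
theorem BaezDuarte2005Moebius_thm_4_4_boundary {φ : ℝ → ℂ} {δ₀ : ℝ} (hδ₀ : 0 < δ₀) (hφ : IsMellinProper φ)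
    (hreal : ∀ u : ℝ, 0 < u → (φ u).im = 0)
    (hNext : ∀ σ : ℝ, -(1 / 2 : ℝ) - δ₀ < σ → σ < δ₀ → HasFiniteMellinNorm φ σ)
    (hne : ∀ s : ℂ, s.re = -(1 / 2 : ℝ) → leftMellin φ s ≠ 0) {ε : ℝ} (hε : 0 < ε) (C : ℝ) :
    (∃ᶠ x in atTop, C < x ^ (1 / 2 + ε) * (moebiusConv φ x).re) ∧
      (∃ᶠ x in atTop, x ^ (1 / 2 + ε) * (moebiusConv φ x).re < C) := by
  have hφm : Measurable φ := hφ.1.1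
  have hN : HasFiniteMellinNorm φ (-(1 / 2 : ℝ)) := hNext _ (by linarith) (by linarith)
  -- a smaller exponent `ε₁ ≤ ε` with `ε₁ < δ₀`, `ε₁ < 1`
  set ε₁ : ℝ := min ε (min (δ₀ / 2) (1 / 2)) with hε₁
  have hε₁0 : 0 < ε₁ := by rw [hε₁]; positivity
  have hε₁ε : ε₁ ≤ ε := min_le_left _ _
  have hε₁δ : ε₁ < δ₀ := lt_of_le_of_lt ((min_le_right _ _).trans (min_le_left _ _)) (by linarith)
  have hε₁1 : ε₁ < 1 := lt_of_le_of_lt ((min_le_right _ _).trans (min_le_right _ _)) (by norm_num)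
  have hα := not_hasFiniteMellinNorm_moebiusConv_of_lt hφ hN hne
    (σ := -(1 / 2 : ℝ) - ε₁ / 4) (by linarith)
  -- from an eventual one-sided bound on `x^{1/2+ε} Gφ(x)` to `η Gφ(x) ≤ C' x^{−1/2−ε₁}`
  have key : ∀ η : ℝ, (η = 1 ∨ η = -1) →
      (∀ᶠ x in atTop, η * (x ^ (1 / 2 + ε) * (moebiusConv φ x).re) ≤ η * C) → False := by
    intro η hη hev
    obtain ⟨X, hX⟩ := (hev.and (eventually_ge_atTop (1 : ℝ))).exists_forall_of_atTop
    refine hα (hasFiniteMellinNorm_moebiusConv_of_oneSided hφm hreal hNext hε₁0 hε₁δ hε₁1 hη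
      (C := max (η * C) 0) (X := X) fun x hx => ?_)
    obtain ⟨h1, h2⟩ := hX x hx
    have hx0 : (0 : ℝ) < x := by linarith
    have hxe : 0 < x ^ (1 / 2 + ε) := Real.rpow_pos_of_pos hx0 _
    -- `η Gφ(x) ≤ η C · x^{−(1/2+ε)}`
    have h3 : η * (moebiusConv φ x).re ≤ η * C * x ^ (-(1 / 2 + ε)) := by
      rw [Real.rpow_neg hx0.le, ← div_eq_mul_inv, le_div_iff₀ hxe]
      linarith
    refine h3.trans ?_
    calc η * C * x ^ (-(1 / 2 + ε)) ≤ max (η * C) 0 * x ^ (-(1 / 2 + ε)) :=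
          mul_le_mul_of_nonneg_right (le_max_left _ _) (Real.rpow_nonneg hx0.le _)
      _ ≤ max (η * C) 0 * x ^ (-(1 / 2 : ℝ) - ε₁) :=
          mul_le_mul_of_nonneg_left (Real.rpow_le_rpow_of_exponent_le h2 (by linarith))
            (le_max_right _ _)
  constructor
  · by_contra h
    rw [not_frequently] at h
    refine key 1 (Or.inl rfl) ?_
    filter_upwards [h] with x hx
    simpa using not_lt.1 hx
  · by_contra h
    rw [not_frequently] at h
    refine key (-1) (Or.inr rfl) ?_
    filter_upwards [h] with x hx
    have := not_lt.1 hx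
    linarith

open BaezDuarteMellin in
/-- **Báez-Duarte 2005, Theorem 4.4 — the printed range `ϑ < 1/2`, realised by an off-line zero.**
If `ζ(ρ₀) = 0` with `1/2 < Re ρ₀ < 1` (so RH fails), then for real Mellin-proper `φ` whose norms
`N_σ(φ)` are finite on `(−1/2, δ₀)` for some `δ₀ > 0`, and every `ε > 0`, `C`:
`x^{1−Re ρ₀+ε} Gφ(x) > C` and `< C` for arbitrarily large `x` — oscillation at the exponent
`ϑ = 1 − Re ρ₀ ∈ (0, 1/2)`, the printed `ϑ = −α` for the pole `ρ₀ − 1` of `φ^∧(s)/(sζ(s+1))`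
((4.13): "there are poles for `f(s)`"; Thm. 4.4: "`ϑ = −α`"). Proof: the general Landau step
`hasFiniteMellinNorm_moebiusConv_of_oneSided_rpow` with `c = Re ρ₀ − 1 − ε` against
`not_hasFiniteMellinNorm_moebiusConv_of_lt_re_zero`. Nothing here bears on the truth of RH (the
hypothesis `ζ(ρ₀) = 0`, `Re ρ₀ > 1/2` is not asserted). [cite: BaezDuarte2005Moebius, Thm. 4.4 (4.14) and (4.13) (IJMMS 2005:22 p. 3607); MontgomeryVaughan2007, §15.1 Lemma 15.1] -/
theorem BaezDuarte2005Moebius_thm_4_4_offLine {φ : ℝ → ℂ} {δ₀ : ℝ} (hδ₀ : 0 < δ₀)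
    (hφ : IsMellinProper φ) (hreal : ∀ u : ℝ, 0 < u → (φ u).im = 0)
    (hNext : ∀ σ : ℝ, -(1 / 2 : ℝ) < σ → σ < δ₀ → HasFiniteMellinNorm φ σ)
    {ρ₀ : ℂ} (hρ : riemannZeta ρ₀ = 0) (hρ1 : 1 / 2 < ρ₀.re) (hρ2 : ρ₀.re < 1)
    {ε : ℝ} (hε : 0 < ε) (C : ℝ) :
    (∃ᶠ x in atTop, C < x ^ (1 - ρ₀.re + ε) * (moebiusConv φ x).re) ∧
      (∃ᶠ x in atTop, x ^ (1 - ρ₀.re + ε) * (moebiusConv φ x).re < C) := by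
  have hφm : Measurable φ := hφ.1.1
  -- a smaller exponent `ε₁ ≤ ε` with `ε₁ < δ₀`, `ε₁ ≤ Re ρ₀ − 1/2`
  set ε₁ : ℝ := min ε (min (δ₀ / 2) (ρ₀.re - 1 / 2)) with hε₁
  have hε₁0 : 0 < ε₁ := by
    rw [hε₁]; exact lt_min hε (lt_min (by linarith) (by linarith))
  have hε₁ε : ε₁ ≤ ε := min_le_left _ _
  have hε₁δ : ε₁ < δ₀ := lt_of_le_of_lt ((min_le_right _ _).trans (min_le_left _ _)) (by linarith)
  have hε₁ρ : ε₁ ≤ ρ₀.re - 1 / 2 := (min_le_right _ _).trans (min_le_right _ _)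
  have hα := not_hasFiniteMellinNorm_moebiusConv_of_lt_re_zero hφ hρ hρ1 hρ2
    (σ := ρ₀.re - 1 - ε₁ + 3 * ε₁ / 4) (by linarith)
  have key : ∀ η : ℝ, (η = 1 ∨ η = -1) →
      (∀ᶠ x in atTop, η * (x ^ (1 - ρ₀.re + ε) * (moebiusConv φ x).re) ≤ η * C) → False := by
    intro η hη hev
    obtain ⟨X, hX⟩ := (hev.and (eventually_ge_atTop (1 : ℝ))).exists_forall_of_atTop
    refine hα (hasFiniteMellinNorm_moebiusConv_of_oneSided_rpow (a₀ := -(1 / 2 : ℝ)) hφm hreal le_rfl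
      hNext (c := ρ₀.re - 1 - ε₁) hε₁0 hε₁δ (by linarith) (by linarith) (by linarith) hη
      (C := max (η * C) 0) (X := X) fun x hx => ?_)
    obtain ⟨h1, h2⟩ := hX x hx
    have hx0 : (0 : ℝ) < x := by linarith
    have hxe : 0 < x ^ (1 - ρ₀.re + ε) := Real.rpow_pos_of_pos hx0 _
    have h3 : η * (moebiusConv φ x).re ≤ η * C * x ^ (-(1 - ρ₀.re + ε)) := by
      rw [Real.rpow_neg hx0.le, ← div_eq_mul_inv, le_div_iff₀ hxe]
      linarith
    refine h3.trans ?_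
    calc η * C * x ^ (-(1 - ρ₀.re + ε)) ≤ max (η * C) 0 * x ^ (-(1 - ρ₀.re + ε)) :=
          mul_le_mul_of_nonneg_right (le_max_left _ _) (Real.rpow_nonneg hx0.le _)
      _ ≤ max (η * C) 0 * x ^ (ρ₀.re - 1 - ε₁) :=
          mul_le_mul_of_nonneg_left (Real.rpow_le_rpow_of_exponent_le h2 (by linarith))
            (le_max_right _ _)
  constructor
  · by_contra h
    rw [not_frequently] at h
    refine key 1 (Or.inl rfl) ?_
    filter_upwards [h] with x hx
    simpa using not_lt.1 hx
  · by_contra h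
    rw [not_frequently] at h
    refine key (-1) (Or.inr rfl) ?_
    filter_upwards [h] with x hx
    have := not_lt.1 hx
    linarith

open BaezDuarteMellin in
/-- **Báez-Duarte 2005, Theorem 4.4, corrected range — PROVED unconditionally.** For real `φ` with
`N_σ(φ) < ∞` on an open interval around `[−1/2, 0]` and `φ^∧ ≠ 0` on `−1/2 ≤ Re s < 0`, there is
`ϑ ∈ [0, 1/2]` (closed at `1/2`; the printed `[0, 1/2)` is the case "RH false") such that for every
`ε > 0`, `limsup x^{ϑ+ε} Gφ(x) = +∞` and `liminf x^{ϑ+ε} Gφ(x) = −∞` (as `∃ᶠ` statements, every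
`C`). By cases: under RH, `ϑ = 1/2` (`BaezDuarte2005Moebius_thm_4_4_boundary`); otherwise a zero
`ρ₀` with `1/2 < Re ρ₀ < 1` exists (`quasiRiemannHypothesis_one_half_iff_holds`) and
`ϑ = 1 − Re ρ₀ < 1/2` (`BaezDuarte2005Moebius_thm_4_4_offLine`). The case split is classical; neither
RH nor its negation is asserted. [cite: BaezDuarte2005Moebius, Thm. 4.4 (4.14) (IJMMS 2005:22 p. 3607)] -/
theorem BaezDuarte2005Moebius_thm_4_4_corrected {φ : ℝ → ℂ} {δ₀ : ℝ} (hδ₀ : 0 < δ₀)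
    (hφ : IsMellinProper φ) (hreal : ∀ u : ℝ, 0 < u → (φ u).im = 0)
    (hNext : ∀ σ : ℝ, -(1 / 2 : ℝ) - δ₀ < σ → σ < δ₀ → HasFiniteMellinNorm φ σ)
    (hne : ∀ s : ℂ, s.re = -(1 / 2 : ℝ) → leftMellin φ s ≠ 0) :
    ∃ ϑ : ℝ, 0 ≤ ϑ ∧ ϑ ≤ 1 / 2 ∧ ∀ ε : ℝ, 0 < ε → ∀ C : ℝ,
      (∃ᶠ x in atTop, C < x ^ (ϑ + ε) * (moebiusConv φ x).re) ∧
        (∃ᶠ x in atTop, x ^ (ϑ + ε) * (moebiusConv φ x).re < C) := by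
  by_cases hRH : RiemannHypothesis
  · exact ⟨1 / 2, by norm_num, le_rfl, fun ε hε C =>
      BaezDuarte2005Moebius_thm_4_4_boundary hδ₀ hφ hreal hNext hne hε C⟩
  · have hq : ¬ QuasiRiemannHypothesis (1 / 2) :=
      fun h => hRH (quasiRiemannHypothesis_one_half_iff_holds.1 h)
    unfold QuasiRiemannHypothesis at hq
    push Not at hq
    obtain ⟨ρ₀, hρ, hρ1, hρ2, -⟩ := hq
    refine ⟨1 - ρ₀.re, by linarith, by linarith, fun ε hε C => ?_⟩
    exact BaezDuarte2005Moebius_thm_4_4_offLine hδ₀ hφ hreal (fun σ h1 h2 => hNext σ (by linarith) h2)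
      hρ hρ1 hρ2 hε C

/-! ## The Hardy–Littlewood function: unconditional oscillation (IJMMS §1, §4 closing remark) -/

namespace BaezDuarteMellin

/-- All weighted norms `N_σ(β)`, `σ < 2`, of the Hardy–Littlewood test function `β(x) = −2x²e^{−x²}`
are finite (`N_σ(β) = 2∫₀^∞ x^{1−σ}e^{−x²} dx`). [cite: BaezDuarte2005Moebius, §3 (3.7) ("both α and β are Mellin-proper")] -/
theorem hasFiniteMellinNorm_hlBeta {σ : ℝ} (hσ : σ < 2) :
    HasFiniteMellinNorm (fun u : ℝ ↦ (((-2 * u ^ 2 * Real.exp (-u ^ 2)) : ℝ) : ℂ)) σ := by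
  unfold HasFiniteMellinNorm
  have h : IntegrableOn (fun x : ℝ ↦ 2 * (x ^ (1 - σ) * Real.exp (-1 * x ^ 2))) (Ioi 0) :=
    (integrableOn_rpow_mul_exp_neg_mul_sq one_pos (by linarith : (-1 : ℝ) < 1 - σ)).const_mul 2
  refine IntegrableOn.congr_fun h (fun u (hu : 0 < u) ↦ ?_) measurableSet_Ioi
  have hβ : ‖(((-2 * u ^ 2 * Real.exp (-u ^ 2)) : ℝ) : ℂ)‖ = 2 * u ^ 2 * Real.exp (-u ^ 2) := by
    rw [Complex.norm_real, Real.norm_eq_abs, show -2 * u ^ 2 * Real.exp (-u ^ 2) =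
      -(2 * u ^ 2 * Real.exp (-u ^ 2)) by ring, abs_neg, abs_of_nonneg (by positivity)]
  rw [hβ, show (-1 : ℝ) * u ^ 2 = -u ^ 2 by ring]
  have hpow : u ^ (-σ - 1) * u ^ 2 = u ^ (1 - σ) := by
    rw [← Real.rpow_natCast u 2, ← Real.rpow_add hu]
    simp only [Nat.cast_ofNat]
    ring_nf
  calc 2 * (u ^ (1 - σ) * Real.exp (-u ^ 2)) = 2 * (u ^ (-σ - 1) * u ^ 2) * Real.exp (-u ^ 2) := by
        rw [hpow]; ring
    _ = u ^ (-σ - 1) * (2 * u ^ 2 * Real.exp (-u ^ 2)) := by ring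

end BaezDuarteMellin

open BaezDuarteMellin in
/-- **Unconditional oscillation of the Hardy–Littlewood function `H`** (IJMMS §1, p. 3600: "it is
shown that both [`R` and `H`] have an infinite number of positive, real zeros, in contrast with
Riesz's statement that `R(x)` has at least one such zero"; §4, p. 3607: "the above results apply to
Riesz's and Hardy–Littlewood's functions through … `H(x²) = Gβ(x)`"): there is `ϑ ∈ [0, 1/2]` such
that for every `ε > 0` and every `C`, `x^{ϑ+ε} H(x²) > C` and `x^{ϑ+ε} H(x²) < C` each hold for
arbitrarily large `x`. Thm. 4.4 (corrected range) for `φ = β`: `β` is real, `N_σ(β) < ∞` for all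
`σ < 2`, and `β^∧(s) = −Γ(1 − s/2)` never vanishes. [cite: BaezDuarte2005Moebius, §1 p. 3600 and §4 p. 3607 (Thm. 4.4 for β, (3.7))] -/
theorem hardyLittlewoodFunction_oscillation :
    ∃ ϑ : ℝ, 0 ≤ ϑ ∧ ϑ ≤ 1 / 2 ∧ ∀ ε : ℝ, 0 < ε → ∀ C : ℝ,
      (∃ᶠ x : ℝ in atTop, C < x ^ (ϑ + ε) * hardyLittlewoodFunction (x ^ 2)) ∧
        (∃ᶠ x : ℝ in atTop, x ^ (ϑ + ε) * hardyLittlewoodFunction (x ^ 2) < C) := by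
  have hNext : ∀ σ : ℝ, -(1 / 2 : ℝ) - 1 < σ → σ < 1 →
      HasFiniteMellinNorm (fun u : ℝ ↦ (((-2 * u ^ 2 * Real.exp (-u ^ 2)) : ℝ) : ℂ)) σ :=
    fun σ _ h2 => hasFiniteMellinNorm_hlBeta (by linarith)
  have hne : ∀ s : ℂ, s.re = -(1 / 2 : ℝ) →
      leftMellin (fun u : ℝ ↦ (((-2 * u ^ 2 * Real.exp (-u ^ 2)) : ℝ) : ℂ)) s ≠ 0 := by
    intro s hs
    rw [leftMellin_hlBeta (by rw [hs]; norm_num)]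
    refine neg_ne_zero.2 (Complex.Gamma_ne_zero_of_re_pos ?_)
    simp only [Complex.sub_re, Complex.one_re, Complex.div_ofNat_re, hs]
    norm_num
  have hreal : ∀ u : ℝ, 0 < u → ((((-2 * u ^ 2 * Real.exp (-u ^ 2)) : ℝ) : ℂ)).im = 0 :=
    fun u _ => Complex.ofReal_im _
  obtain ⟨ϑ, h0, h1, h⟩ := BaezDuarte2005Moebius_thm_4_4_corrected one_pos isMellinProper_hlBeta
    hreal hNext hne
  refine ⟨ϑ, h0, h1, fun ε hε C => ?_⟩
  obtain ⟨hA, hB⟩ := h ε hε C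
  have hev : ∀ᶠ x : ℝ in atTop, (moebiusConv (fun u : ℝ ↦ (((-2 * u ^ 2 * Real.exp (-u ^ 2)) : ℝ) : ℂ)) x).re
      = hardyLittlewoodFunction (x ^ 2) := by
    filter_upwards [eventually_gt_atTop (0 : ℝ)] with x hx
    rw [moebiusConv_hlBeta_eq hx, Complex.ofReal_re]
  constructor
  · refine (hA.and_eventually hev).mono ?_
    rintro x ⟨h1, h2⟩
    rwa [h2] at h1
  · refine (hB.and_eventually hev).mono ?_
    rintro x ⟨h1, h2⟩
    rwa [h2] at h1

/-- **`H` changes sign beyond every bound** — hence has infinitely many positive real zeros (IJMMS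
§1, p. 3600), unconditionally: `H(y) > 0` for arbitrarily large `y` and `H(y) < 0` for arbitrarily
large `y`. [cite: BaezDuarte2005Moebius, §1 p. 3600 ("an infinite number of positive, real zeros")] -/
theorem hardyLittlewoodFunction_frequently_pos_and_neg :
    (∃ᶠ y : ℝ in atTop, 0 < hardyLittlewoodFunction y) ∧
      (∃ᶠ y : ℝ in atTop, hardyLittlewoodFunction y < 0) := by
  obtain ⟨ϑ, -, -, h⟩ := hardyLittlewoodFunction_oscillation
  obtain ⟨hA, hB⟩ := h 1 one_pos 0
  have hsq : Tendsto (fun x : ℝ => x ^ 2) atTop atTop := tendsto_pow_atTop two_ne_zero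
  constructor
  · refine hsq.frequently ((hA.and_eventually (eventually_gt_atTop (0 : ℝ))).mono ?_)
    rintro x ⟨h1, h2⟩
    exact pos_of_mul_pos_right h1 (Real.rpow_nonneg h2.le _)
  · refine hsq.frequently ((hB.and_eventually (eventually_gt_atTop (0 : ℝ))).mono ?_)
    rintro x ⟨h1, h2⟩
    have hx : 0 < x ^ (ϑ + 1) := Real.rpow_pos_of_pos h2 _
    by_contra hneg
    push Not at hneg
    have := mul_nonneg hx.le hneg
    linarith

/-! ## The unconditional `L²` clauses: `‖g₁‖₂ = ∞` (Thm. 2.3) and `‖ψ‖₂ = ∞` (Thm. 4.2 (4.6)) -/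

namespace BaezDuarteMellin

/-- Young's inequality with a parameter: `a b ≤ (λ a² + b²/λ)/2` for `λ > 0`. [folklore] -/
private theorem mul_le_param_sq (a b : ℝ) {l : ℝ} (hl : 0 < l) :
    a * b ≤ (l * a ^ 2 + b ^ 2 / l) / 2 := by
  have h : (l * a ^ 2 + b ^ 2 / l) / 2 - a * b = (l * a - b) ^ 2 / (2 * l) := by
    field_simp
    ring
  have h2 : 0 ≤ (l * a - b) ^ 2 / (2 * l) := div_nonneg (sq_nonneg _) (by positivity)
  linarith

/-- **The Cauchy–Schwarz step behind `‖·‖₂ = ∞`** (the rôle of [1, Lemma 2.3] in the proofs of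
Thms 2.3 and 4.2): if `∫₁^∞ |F(u)|² du < ∞` then for `0 < h`,
`∫₁^∞ x^{−1/2−h}|F(x)| dx ≤ h^{−1/2}(∫₁^∞|F|² + 1/2)/2` — so the weighted norms `N_{−1/2+h}(F)` over
`(1,∞)` are finite and `O(h^{−1/2})` as `h ↓ 0` (pointwise `|F| x^{−1/2−h} ≤ (λ|F|² + x^{−1−2h}/λ)/2`,
`λ = h^{−1/2}`). [cite: BaezDuarte2005Moebius, Thm. 2.3 proof ("[1, Lemma 2.3] implies ‖g‖₂ = ∞") and Thm. 4.2 proof] -/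
theorem integral_rpow_mul_norm_le_of_sq_integrable {F : ℝ → ℂ} (hFm : Measurable F)
    (hF2 : IntegrableOn (fun u : ℝ => ‖F u‖ ^ 2) (Ioi 1)) {h : ℝ} (hh : 0 < h) :
    IntegrableOn (fun x : ℝ => x ^ (-(-(1 / 2 : ℝ) + h) - 1) * ‖F x‖) (Ioi 1) ∧
      ∫ x in Ioi (1 : ℝ), x ^ (-(-(1 / 2 : ℝ) + h) - 1) * ‖F x‖ ≤
        h ^ (-(1 / 2 : ℝ)) * ((∫ u in Ioi (1 : ℝ), ‖F u‖ ^ 2) + 1 / 2) / 2 := by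
  set l : ℝ := h ^ (-(1 / 2 : ℝ)) with hl
  have hl0 : 0 < l := by rw [hl]; exact Real.rpow_pos_of_pos hh _
  have hmaj_int : IntegrableOn (fun x : ℝ => (l * ‖F x‖ ^ 2 + x ^ (-1 - 2 * h) / l) / 2) (Ioi 1) :=
    ((hF2.const_mul l).add ((integrableOn_Ioi_rpow_of_lt (by linarith) zero_lt_one).div_const l)).div_const 2
  have hmeas : Measurable fun x : ℝ => x ^ (-(-(1 / 2 : ℝ) + h) - 1) * ‖F x‖ :=
    (measurable_id.pow_const _).mul hFm.norm
  have hle : ∀ x ∈ Ioi (1 : ℝ), x ^ (-(-(1 / 2 : ℝ) + h) - 1) * ‖F x‖ ≤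
      (l * ‖F x‖ ^ 2 + x ^ (-1 - 2 * h) / l) / 2 := by
    intro x hx
    have hx0 : (0 : ℝ) < x := lt_trans zero_lt_one hx
    have h1 := mul_le_param_sq ‖F x‖ (x ^ (-(-(1 / 2 : ℝ) + h) - 1)) hl0
    rw [mul_comm] at h1
    have hsq : (x ^ (-(-(1 / 2 : ℝ) + h) - 1)) ^ 2 = x ^ (-1 - 2 * h) := by
      rw [← Real.rpow_natCast, ← Real.rpow_mul hx0.le]
      congr 1; push_cast; ring
    rwa [hsq] at h1
  have hint : IntegrableOn (fun x : ℝ => x ^ (-(-(1 / 2 : ℝ) + h) - 1) * ‖F x‖) (Ioi 1) := by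
    refine Integrable.mono' hmaj_int hmeas.aestronglyMeasurable ?_
    refine ae_restrict_of_forall_mem measurableSet_Ioi fun x hx => ?_
    rw [Real.norm_eq_abs, abs_of_nonneg (mul_nonneg (Real.rpow_nonneg (le_of_lt
      (lt_trans zero_lt_one hx)) _) (norm_nonneg _))]
    exact hle x hx
  refine ⟨hint, ?_⟩
  calc ∫ x in Ioi (1 : ℝ), x ^ (-(-(1 / 2 : ℝ) + h) - 1) * ‖F x‖
      ≤ ∫ x in Ioi (1 : ℝ), (l * ‖F x‖ ^ 2 + x ^ (-1 - 2 * h) / l) / 2 :=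
        setIntegral_mono_on hint hmaj_int measurableSet_Ioi hle
    _ = (l * (∫ u in Ioi (1 : ℝ), ‖F u‖ ^ 2) + (∫ x in Ioi (1 : ℝ), x ^ (-1 - 2 * h)) / l) / 2 := by
        rw [integral_div, integral_add (hF2.const_mul l)
          ((integrableOn_Ioi_rpow_of_lt (by linarith) zero_lt_one).div_const l),
          integral_const_mul, integral_div]
    _ = l * ((∫ u in Ioi (1 : ℝ), ‖F u‖ ^ 2) + 1 / 2) / 2 := by
        rw [integral_Ioi_rpow_of_lt (by linarith) zero_lt_one, Real.one_rpow]
        have hll : l * l = h⁻¹ := by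
          rw [hl, ← Real.rpow_add hh, show -(1 / 2 : ℝ) + -(1 / 2 : ℝ) = -1 by norm_num,
            Real.rpow_neg_one]
        have h2 : -(1 : ℝ) / (-1 - 2 * h + 1) / l = l / 2 := by
          have hh0' : h ≠ 0 := hh.ne'
          rw [show -1 - 2 * h + 1 = -(2 * h) by ring,
            show -(1 : ℝ) / (-(2 * h)) / l = 1 / (2 * h * l) by
              have hl0' : l ≠ 0 := hl0.ne'
              field_simp,
            div_eq_div_iff (by positivity) two_ne_zero, one_mul]
          calc (2 : ℝ) = 2 * (h * h⁻¹) := by rw [mul_inv_cancel₀ hh0', mul_one]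
            _ = l * (2 * h * l) := by rw [← hll]; ring
        rw [h2]; ring

/-- `‖h^∧(s)‖ ≤ N_{Re s}(h)` for the left-Mellin transform. [cite: BaezDuarte2005Moebius, §2 Lemma 2.1] -/
theorem norm_leftMellin_le {f : ℝ → ℂ} (s : ℂ) :
    ‖leftMellin f s‖ ≤ ∫ x in Ioi (0 : ℝ), x ^ (-s.re - 1) * ‖f x‖ := by
  unfold leftMellin
  refine (norm_integral_le_integral_norm _).trans (le_of_eq ?_)
  refine setIntegral_congr_fun measurableSet_Ioi fun x hx => ?_
  have hx0 : (0 : ℝ) < x := hx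
  rw [norm_mul, Complex.norm_cpow_eq_rpow_re_of_pos hx0]
  simp

end BaezDuarteMellin

open BaezDuarteMellin in
/-- **Báez-Duarte 2005, Theorem 2.3, the unconditional clause: `‖g₁‖₂ = ∞`** (IJMMS p. 3602:
"and, unconditionally, `‖g₁‖₂ = ∞`"; `g₁(x) = x⁻¹g(x⁻¹)`, so `‖g₁‖₂² = ∫₁^∞ g(u)² du`). Printed
proof: `f(x) = ∫₀^x g` has Mellin transform `1/(s(s−1)ζ(s))` with poles on `Re s = 1/2`, so
`f ≠ o(x^{1/2})` by the order Lemma 2.1 of [1], while [1, Lemma 2.3] gives `f = o(x^{1/2})` from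
`‖g‖₂ < ∞`. Here directly on `g`: if `∫₁^∞ g² < ∞` then (Cauchy–Schwarz, in Young's form)
`N_{−1/2+h}(g) ≤ M h^{−1/2}`, so `g^∧` is holomorphic on `Re s > −1/2` and (2.12)
`ζ(s+1)·s g^∧(s) = 1` persists there (identity theorem on the upper half-strip); at
`s = ρ − 1 + h`, `ρ = 1/2 + iγ₀` the certified first zero of `ζ`, this gives
`1 ≤ K h · L · M h^{−1/2} → 0`. Nothing here bears on the truth of RH. [cite: BaezDuarte2005Moebius, Thm. 2.3 (2.14), second clause (IJMMS 2005:22 p. 3602; arXiv Thm. 2.2)] -/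
theorem BaezDuarte2005Moebius_thm_2_3_normSq :
    ¬ IntegrableOn (fun x : ℝ ↦ |x⁻¹ * moebiusDivSum x⁻¹| ^ (2 : ℝ)) (Ioi 0) := by
  intro hint
  have h2 : IntegrableOn (fun u : ℝ => |moebiusDivSum u| ^ (2 : ℝ) * u ^ ((2 : ℝ) - 2)) (Ioi 1) :=
    (integrableOn_abs_inv_mul_moebiusDivSum_rpow_iff two_pos).1 hint
  set gc : ℝ → ℂ := fun x => (moebiusDivSum x : ℂ) with hgc
  have hgcm : Measurable gc := Complex.measurable_ofReal.comp measurable_moebiusDivSum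
  have hF2 : IntegrableOn (fun u : ℝ => ‖gc u‖ ^ 2) (Ioi 1) := by
    refine h2.congr_fun (fun u _ => ?_) measurableSet_Ioi
    simp only [hgc, Complex.norm_real, Real.norm_eq_abs, sub_self, Real.rpow_zero, mul_one,
      Real.rpow_two]
  set G₂ : ℝ := ∫ u in Ioi (1 : ℝ), ‖gc u‖ ^ 2 with hG₂
  have hG₂0 : 0 ≤ G₂ := setIntegral_nonneg measurableSet_Ioi fun u _ => sq_nonneg _
  set M : ℝ := (G₂ + 1 / 2) / 2 + 1 with hM
  have hM0 : 0 < M := by rw [hM]; positivity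
  -- the norms `N_{−1/2+h}(g) ≤ M h^{−1/2}` for `0 < h ≤ 1`
  have hNg : ∀ h : ℝ, 0 < h → h ≤ 1 → HasFiniteMellinNorm gc (-(1 / 2 : ℝ) + h) ∧
      ∫ x in Ioi (0 : ℝ), x ^ (-(-(1 / 2 : ℝ) + h) - 1) * ‖gc x‖ ≤ M * h ^ (-(1 / 2 : ℝ)) := by
    intro h hh0 hh1
    obtain ⟨hI1, hB1⟩ := integral_rpow_mul_norm_le_of_sq_integrable hgcm hF2 hh0
    -- the piece over `(0,1]` is bounded by `1`
    have hmeas : Measurable fun x : ℝ => x ^ (-(-(1 / 2 : ℝ) + h) - 1) * ‖gc x‖ :=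
      (measurable_id.pow_const _).mul hgcm.norm
    have hle01 : ∀ x ∈ Ioc (0 : ℝ) 1, x ^ (-(-(1 / 2 : ℝ) + h) - 1) * ‖gc x‖ ≤ 1 := by
      intro x hx
      rcases eq_or_lt_of_le hx.2 with h1 | h1
      · rw [h1, Real.one_rpow, one_mul, hgc]
        simp only [Complex.norm_real, Real.norm_eq_abs]
        exact abs_moebiusDivSum_le_self zero_le_one
      · rw [hgc]
        simp only [moebiusDivSum_of_lt_one h1, Complex.ofReal_zero, norm_zero, mul_zero]
        exact zero_le_one
    have hI0 : IntegrableOn (fun x : ℝ => x ^ (-(-(1 / 2 : ℝ) + h) - 1) * ‖gc x‖) (Ioc 0 1) := by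
      refine Integrable.mono' (integrableOn_const (C := (1 : ℝ)) (hs := measure_Ioc_lt_top.ne))
        hmeas.aestronglyMeasurable ?_
      refine ae_restrict_of_forall_mem measurableSet_Ioc fun x hx => ?_
      rw [Real.norm_eq_abs, abs_of_nonneg (mul_nonneg (Real.rpow_nonneg hx.1.le _) (norm_nonneg _))]
      exact hle01 x hx
    have hunion : Ioi (0 : ℝ) = Ioc 0 1 ∪ Ioi 1 := (Ioc_union_Ioi_eq_Ioi zero_le_one).symm
    refine ⟨?_, ?_⟩
    · unfold HasFiniteMellinNorm
      rw [hunion]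
      exact hI0.union hI1
    · have hdisj : Disjoint (Ioc (0 : ℝ) 1) (Ioi 1) :=
        Set.disjoint_left.2 fun t ht ht' => (not_lt.2 ht.2) ht'
      rw [hunion, setIntegral_union hdisj measurableSet_Ioi hI0 hI1]
      have hp0 : ∫ x in Ioc (0 : ℝ) 1, x ^ (-(-(1 / 2 : ℝ) + h) - 1) * ‖gc x‖ ≤ 1 := by
        calc ∫ x in Ioc (0 : ℝ) 1, x ^ (-(-(1 / 2 : ℝ) + h) - 1) * ‖gc x‖
            ≤ ∫ x in Ioc (0 : ℝ) 1, (1 : ℝ) :=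
              setIntegral_mono_on hI0 (integrableOn_const (hs := measure_Ioc_lt_top.ne))
                measurableSet_Ioc hle01
          _ = 1 := by simp
      have hhpow : 1 ≤ h ^ (-(1 / 2 : ℝ)) :=
        Real.one_le_rpow_of_pos_of_le_one_of_nonpos hh0 hh1 (by norm_num)
      calc (∫ x in Ioc (0 : ℝ) 1, x ^ (-(-(1 / 2 : ℝ) + h) - 1) * ‖gc x‖) +
            ∫ x in Ioi (1 : ℝ), x ^ (-(-(1 / 2 : ℝ) + h) - 1) * ‖gc x‖
          ≤ 1 + h ^ (-(1 / 2 : ℝ)) * (G₂ + 1 / 2) / 2 := add_le_add hp0 hB1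
        _ ≤ M * h ^ (-(1 / 2 : ℝ)) := by
            rw [hM]; nlinarith [hhpow, hG₂0]
  -- `g^∧` is holomorphic on `−1/2 < Re s < 2`
  set Mg : ℂ → ℂ := leftMellin gc with hMg
  have hNall : ∀ σ : ℝ, -(1 / 2 : ℝ) < σ → σ < 2 → HasFiniteMellinNorm gc σ := by
    intro σ h1 _
    rcases le_or_gt 0 σ with h0 | h0
    · exact hasFiniteMellinNorm_moebiusDivSum h0
    · have := (hNg (σ + 1 / 2) (by linarith) (by linarith)).1
      rwa [show -(1 / 2 : ℝ) + (σ + 1 / 2) = σ by ring] at this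
  have hSo : IsOpen {s : ℂ | -(1 / 2 : ℝ) < s.re ∧ s.re < 2} :=
    (isOpen_lt continuous_const Complex.continuous_re).inter
      (isOpen_lt Complex.continuous_re continuous_const)
  have hMd : DifferentiableOn ℂ Mg {s : ℂ | -(1 / 2 : ℝ) < s.re ∧ s.re < 2} :=
    differentiableOn_leftMellin hgcm hNall
  -- `E(s) = ζ(s+1)(s g^∧(s)) − 1 ≡ 0` on the upper half-strip
  set E : ℂ → ℂ := fun s => riemannZeta (s + 1) * (s * Mg s) - 1 with hE
  have hUo : IsOpen {s : ℂ | (-(1 / 2 : ℝ) < s.re ∧ s.re < 2) ∧ 0 < s.im} :=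
    hSo.inter (isOpen_lt continuous_const Complex.continuous_im)
  have hUc : Convex ℝ {s : ℂ | (-(1 / 2 : ℝ) < s.re ∧ s.re < 2) ∧ 0 < s.im} :=
    ((convex_halfSpace_re_gt _).inter (convex_halfSpace_re_lt _)).inter (convex_halfSpace_im_gt _)
  have hEU : EqOn E 0 {s : ℂ | (-(1 / 2 : ℝ) < s.re ∧ s.re < 2) ∧ 0 < s.im} := by
    have ha : AnalyticOnNhd ℂ E {s : ℂ | (-(1 / 2 : ℝ) < s.re ∧ s.re < 2) ∧ 0 < s.im} := by
      refine DifferentiableOn.analyticOnNhd (fun s hs => ?_) hUo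
      have hne1 : s + 1 ≠ 1 := by
        intro h
        have := congrArg Complex.im h
        simp only [Complex.add_im, Complex.one_im, add_zero] at this
        exact hs.2.ne' this
      have h1 : DifferentiableAt ℂ (fun z : ℂ => riemannZeta (z + 1)) s :=
        (differentiableAt_riemannZeta hne1).comp s (f := fun z : ℂ => z + 1)
          (differentiableAt_id.add_const 1)
      have h2 : DifferentiableAt ℂ Mg s := hMd.differentiableAt (hSo.mem_nhds hs.1)
      exact ((h1.mul (differentiableAt_id.mul h2)).sub_const 1).differentiableWithinAt
    have hz₁ : (1 : ℂ) + I ∈ {s : ℂ | (-(1 / 2 : ℝ) < s.re ∧ s.re < 2) ∧ 0 < s.im} := by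
      simp only [mem_setOf_eq, Complex.add_re, Complex.one_re, Complex.I_re, Complex.add_im,
        Complex.one_im, Complex.I_im]
      norm_num
    have hev : E =ᶠ[𝓝 ((1 : ℂ) + I)] 0 := by
      filter_upwards [(isOpen_lt continuous_const Complex.continuous_re).mem_nhds
        (show (0 : ℝ) < ((1 : ℂ) + I).re by simp)] with s hs
      have hs' : 0 < s.re := hs
      simp only [hE, hMg, hgc, Pi.zero_apply]
      rw [riemannZeta_mul_leftMellin_moebiusDivSum hs', sub_self]
    exact ha.eqOn_zero_of_preconnected_of_eventuallyEq_zero hUc.isPreconnected hz₁ hev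
  -- the certified critical zero `ρ = 1/2 + iγ₀`
  obtain ⟨γ, hγ, hρ⟩ := exists_zero_Icc_first_bracket
  set ρ : ℂ := 1 / 2 + (γ : ℂ) * I with hρdef
  have hγ0 : 0 < γ := lt_of_lt_of_le (by norm_num) hγ.1
  have hre : ρ.re = 1 / 2 := by simp [hρdef]
  have him : ρ.im = γ := by simp [hρdef]
  have hρ1 : ρ ≠ 1 := by
    intro h
    have := congrArg Complex.re h
    rw [hre, Complex.one_re] at this
    norm_num at this
  obtain ⟨K, r, hK, hr, hζK⟩ := exists_norm_riemannZeta_le_mul_of_zero hρ hρ1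
  set L : ℝ := ‖ρ - 1‖ + 1 with hL
  have hLpos : 0 < L := by rw [hL]; positivity
  -- for small `h > 0`: `1 ≤ K L M √h`
  have key : ∀ h : ℝ, 0 < h → h < min r (1 / 2) → (1 : ℝ) ≤ K * L * M * h ^ (1 / 2 : ℝ) := by
    intro h hh0 hh1
    have hhr : h < r := lt_of_lt_of_le hh1 (min_le_left _ _)
    have hh2 : h < 1 / 2 := lt_of_lt_of_le hh1 (min_le_right _ _)
    set w : ℂ := ρ - 1 + (h : ℂ) with hw
    have hwre : w.re = -(1 / 2 : ℝ) + h := by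
      rw [hw, Complex.add_re, Complex.sub_re, Complex.one_re, hre, Complex.ofReal_re]; ring
    have hwim : w.im = γ := by
      rw [hw, Complex.add_im, Complex.sub_im, Complex.one_im, him, Complex.ofReal_im]; ring
    have hwU : w ∈ {s : ℂ | (-(1 / 2 : ℝ) < s.re ∧ s.re < 2) ∧ 0 < s.im} := by
      refine ⟨⟨?_, ?_⟩, ?_⟩
      · rw [hwre]; linarith
      · rw [hwre]; linarith
      · rw [hwim]; exact hγ0
    have hEw := hEU hwU
    simp only [hE, Pi.zero_apply, sub_eq_zero] at hEw
    -- `hEw : ζ(w+1) * (w * Mg w) = 1`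
    have hw1 : w + 1 = ρ + h := by rw [hw]; ring
    rw [hw1] at hEw
    have hnorm : (1 : ℝ) = ‖riemannZeta (ρ + h)‖ * (‖w‖ * ‖Mg w‖) := by
      rw [← norm_mul, ← norm_mul, hEw, norm_one]
    have hζ := hζK h hh0 hhr
    have hwL : ‖w‖ ≤ L := by
      rw [hL, hw]
      calc ‖ρ - 1 + (h : ℂ)‖ ≤ ‖ρ - 1‖ + ‖(h : ℂ)‖ := norm_add_le _ _
        _ ≤ ‖ρ - 1‖ + 1 := by
            rw [Complex.norm_real, Real.norm_of_nonneg hh0.le]; linarith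
    have hMgw : ‖Mg w‖ ≤ M * h ^ (-(1 / 2 : ℝ)) := by
      have h1 := norm_leftMellin_le (f := gc) w
      rw [hwre] at h1
      exact h1.trans (hNg h hh0 (by linarith)).2
    have hprod : ‖riemannZeta (ρ + h)‖ * (‖w‖ * ‖Mg w‖) ≤ K * h * (L * (M * h ^ (-(1 / 2 : ℝ)))) :=
      mul_le_mul hζ (mul_le_mul hwL hMgw (norm_nonneg _) hLpos.le)
        (mul_nonneg (norm_nonneg _) (norm_nonneg _)) (by positivity)
    have hpow : h * h ^ (-(1 / 2 : ℝ)) = h ^ (1 / 2 : ℝ) := by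
      conv_lhs => rw [show h = h ^ (1 : ℝ) by rw [Real.rpow_one]]
      rw [Real.rpow_one, ← Real.rpow_one_add' hh0.le (by norm_num)]
      norm_num
    calc (1 : ℝ) = ‖riemannZeta (ρ + h)‖ * (‖w‖ * ‖Mg w‖) := hnorm
      _ ≤ K * h * (L * (M * h ^ (-(1 / 2 : ℝ)))) := hprod
      _ = K * L * M * (h * h ^ (-(1 / 2 : ℝ))) := by ring
      _ = K * L * M * h ^ (1 / 2 : ℝ) := by rw [hpow]
  -- `h ↓ 0`
  have hlim : Tendsto (fun h : ℝ => K * L * M * h ^ (1 / 2 : ℝ)) (𝓝[>] 0) (𝓝 (K * L * M * 0)) := by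
    have hc : Tendsto (fun h : ℝ => h ^ (1 / 2 : ℝ)) (𝓝[>] 0) (𝓝 0) := by
      have := (Real.continuousAt_rpow_const (0 : ℝ) (1 / 2) (Or.inr (by norm_num))).tendsto
      rw [Real.zero_rpow (by norm_num)] at this
      exact this.mono_left nhdsWithin_le_nhds
    exact hc.const_mul _
  rw [mul_zero] at hlim
  have hev : ∀ᶠ h in 𝓝[>] (0 : ℝ), (1 : ℝ) ≤ K * L * M * h ^ (1 / 2 : ℝ) := by
    filter_upwards [Ioo_mem_nhdsGT (show (0 : ℝ) < min r (1 / 2) by positivity)] with h hh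
    exact key h hh.1 hh.2
  have := ge_of_tendsto hlim hev
  linarith

open BaezDuarteMellin in
/-- **Báez-Duarte 2005, Theorem 4.2, the unconditional clause (4.6): `‖ψ‖₂ = ∞`** (IJMMS
p. 3606: "Furthermore, unconditionally on RH, if `φ^∧(s) ∈ A[−1/2, 0)` does not vanish on the line
`σ = −1/2`, then `‖ψ‖₂ = ∞`"; `ψ(x) = x⁻¹Gφ(x⁻¹)`). Printed proof via `f(x) = ∫₀^x Gφ`, (4.9) and
[1, Lemmas 2.1, 2.3]; here directly: `∫₀^∞ |Gφ|² < ∞` gives `N_{−1/2+h}(Gφ) ≤ M h^{−1/2}`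
(Cauchy–Schwarz in Young's form, plus `N_0(Gφ) < ∞` on `(0,1]`), so `(Gφ)^∧` is holomorphic on
`−1/2 < Re s < 0` and (3.11) `φ^∧(s) = (Gφ)^∧(s)·sζ(s+1)` holds there; at `s = ρ − 1 + h` (`ρ` the
certified first zero) `0 < b ≤ ‖φ^∧(s)‖ ≤ M h^{−1/2} · L · K h → 0`. Hypotheses as printed: `φ`
Mellin-proper, `N_{−1/2}(φ) < ∞` (so `φ^∧ ∈ A^c[−1/2, 0]`), `φ^∧ ≠ 0` on `Re s = −1/2`. Nothing
here bears on the truth of RH. [cite: BaezDuarte2005Moebius, Thm. 4.2 (4.6) (IJMMS 2005:22 p. 3606)] -/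
theorem BaezDuarte2005Moebius_thm_4_2_normSq {φ : ℝ → ℂ} (hφ : IsMellinProper φ)
    (hN : HasFiniteMellinNorm φ (-(1 / 2 : ℝ)))
    (hne : ∀ s : ℂ, s.re = -(1 / 2 : ℝ) → leftMellin φ s ≠ 0) :
    ¬ IntegrableOn (fun x : ℝ ↦ ‖(x : ℂ)⁻¹ * moebiusConv φ x⁻¹‖ ^ (2 : ℝ)) (Ioi 0) := by
  intro hint
  have hφm : Measurable φ := hφ.1.1
  set G : ℝ → ℂ := moebiusConv φ with hGdef
  have hGm : Measurable G := measurable_moebiusConv hφm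
  have h2 : IntegrableOn (fun u : ℝ => ‖G u‖ ^ (2 : ℝ) * u ^ ((2 : ℝ) - 2)) (Ioi 0) :=
    (integrableOn_norm_inv_mul_rpow_iff (moebiusConv φ) 2).1 hint
  have hF2 : IntegrableOn (fun u : ℝ => ‖G u‖ ^ 2) (Ioi 1) := by
    refine (h2.mono_set (Ioi_subset_Ioi zero_le_one)).congr_fun (fun u _ => ?_) measurableSet_Ioi
    simp only [sub_self, Real.rpow_zero, mul_one, Real.rpow_two]
  have hG0 := hasFiniteMellinNorm_moebiusConv_zero hφ.1
  set G₂ : ℝ := ∫ u in Ioi (1 : ℝ), ‖G u‖ ^ 2 with hG₂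
  have hG₂0 : 0 ≤ G₂ := setIntegral_nonneg measurableSet_Ioi fun u _ => sq_nonneg _
  set A : ℝ := ∫ x in Ioi (0 : ℝ), x ^ (-(0 : ℝ) - 1) * ‖G x‖ with hA
  have hA0 : 0 ≤ A := setIntegral_nonneg measurableSet_Ioi fun x hx =>
    mul_nonneg (Real.rpow_nonneg (le_of_lt hx) _) (norm_nonneg _)
  set M : ℝ := (G₂ + 1 / 2) / 2 + A + 1 with hM
  have hM0 : 0 < M := by rw [hM]; positivity
  -- the norms `N_{−1/2+h}(Gφ) ≤ M h^{−1/2}` for `0 < h < 1/2`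
  have hNG : ∀ h : ℝ, 0 < h → h < 1 / 2 → HasFiniteMellinNorm G (-(1 / 2 : ℝ) + h) ∧
      ∫ x in Ioi (0 : ℝ), x ^ (-(-(1 / 2 : ℝ) + h) - 1) * ‖G x‖ ≤ M * h ^ (-(1 / 2 : ℝ)) := by
    intro h hh0 hh1
    obtain ⟨hI1, hB1⟩ := integral_rpow_mul_norm_le_of_sq_integrable hGm hF2 hh0
    have hmeas : Measurable fun x : ℝ => x ^ (-(-(1 / 2 : ℝ) + h) - 1) * ‖G x‖ :=
      (measurable_id.pow_const _).mul hGm.norm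
    have hG0' := hG0
    unfold HasFiniteMellinNorm at hG0'
    have hle01 : ∀ x ∈ Ioc (0 : ℝ) 1, x ^ (-(-(1 / 2 : ℝ) + h) - 1) * ‖G x‖ ≤
        x ^ (-(0 : ℝ) - 1) * ‖G x‖ := fun x hx =>
      mul_le_mul_of_nonneg_right (Real.rpow_le_rpow_of_exponent_ge hx.1 hx.2 (by linarith))
        (norm_nonneg _)
    have hI0 : IntegrableOn (fun x : ℝ => x ^ (-(-(1 / 2 : ℝ) + h) - 1) * ‖G x‖) (Ioc 0 1) := by
      refine Integrable.mono' (hG0'.mono_set Ioc_subset_Ioi_self) hmeas.aestronglyMeasurable ?_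
      refine ae_restrict_of_forall_mem measurableSet_Ioc fun x hx => ?_
      rw [Real.norm_eq_abs, abs_of_nonneg (mul_nonneg (Real.rpow_nonneg hx.1.le _) (norm_nonneg _))]
      exact hle01 x hx
    have hunion : Ioi (0 : ℝ) = Ioc 0 1 ∪ Ioi 1 := (Ioc_union_Ioi_eq_Ioi zero_le_one).symm
    refine ⟨?_, ?_⟩
    · unfold HasFiniteMellinNorm
      rw [hunion]
      exact hI0.union hI1
    · have hdisj : Disjoint (Ioc (0 : ℝ) 1) (Ioi 1) :=
        Set.disjoint_left.2 fun t ht ht' => (not_lt.2 ht.2) ht'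
      rw [hunion, setIntegral_union hdisj measurableSet_Ioi hI0 hI1]
      have hp0 : ∫ x in Ioc (0 : ℝ) 1, x ^ (-(-(1 / 2 : ℝ) + h) - 1) * ‖G x‖ ≤ A := by
        calc ∫ x in Ioc (0 : ℝ) 1, x ^ (-(-(1 / 2 : ℝ) + h) - 1) * ‖G x‖
            ≤ ∫ x in Ioc (0 : ℝ) 1, x ^ (-(0 : ℝ) - 1) * ‖G x‖ :=
              setIntegral_mono_on hI0 (hG0'.mono_set Ioc_subset_Ioi_self) measurableSet_Ioc hle01
          _ ≤ A := setIntegral_mono_set hG0'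
              (ae_restrict_of_forall_mem measurableSet_Ioi fun x hx =>
                mul_nonneg (Real.rpow_nonneg (le_of_lt hx) _) (norm_nonneg _))
              Ioc_subset_Ioi_self.eventuallyLE
      have hhpow : 1 ≤ h ^ (-(1 / 2 : ℝ)) :=
        Real.one_le_rpow_of_pos_of_le_one_of_nonpos hh0 (by linarith) (by norm_num)
      calc (∫ x in Ioc (0 : ℝ) 1, x ^ (-(-(1 / 2 : ℝ) + h) - 1) * ‖G x‖) +
            ∫ x in Ioi (1 : ℝ), x ^ (-(-(1 / 2 : ℝ) + h) - 1) * ‖G x‖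
          ≤ A + h ^ (-(1 / 2 : ℝ)) * (G₂ + 1 / 2) / 2 := add_le_add hp0 hB1
        _ ≤ M * h ^ (-(1 / 2 : ℝ)) := by
            rw [hM]; nlinarith [hhpow, hG₂0, hA0]
  -- (3.11) on the strip, from the norms
  have hGσ : ∀ σ : ℝ, -(1 / 2 : ℝ) < σ → σ < 0 → HasFiniteMellinNorm G σ := by
    intro σ h1 h2
    have := (hNG (σ + 1 / 2) (by linarith) (by linarith)).1
    rwa [show -(1 / 2 : ℝ) + (σ + 1 / 2) = σ by ring] at this
  have h311 : ∀ s : ℂ, -(1 / 2 : ℝ) < s.re → s.re < 0 →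
      leftMellin G s * (s * riemannZeta (s + 1)) = leftMellin φ s :=
    fun s hs1 hs2 => leftMellin_moebiusConv_mul_eq_of_hasFiniteMellinNorm hφ.1 hGσ hs1 hs2
  -- the certified critical zero and the constants
  obtain ⟨γ, -, hρ⟩ := exists_zero_Icc_first_bracket
  set ρ : ℂ := 1 / 2 + (γ : ℂ) * I with hρdef
  have hre : ρ.re = 1 / 2 := by simp [hρdef]
  have hρ1 : ρ ≠ 1 := by
    intro h
    have := congrArg Complex.re h
    rw [hre, Complex.one_re] at this
    norm_num at this
  obtain ⟨K, r, hK, hr, hζK⟩ := exists_norm_riemannZeta_le_mul_of_zero hρ hρ1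
  have hs₀re : (ρ - 1).re = -(1 / 2 : ℝ) := by rw [Complex.sub_re, Complex.one_re, hre]; norm_num
  have hb0 : 0 < ‖leftMellin φ (ρ - 1)‖ := norm_pos_iff.2 (hne _ hs₀re)
  have hcont : ContinuousWithinAt (leftMellin φ) {s : ℂ | -(1 / 2 : ℝ) ≤ s.re ∧ s.re ≤ 0} (ρ - 1) :=
    continuousWithinAt_leftMellin hφm hN (hφ.1.2 0 (by norm_num) le_rfl) (ρ - 1)
  obtain ⟨δ, hδ0, hδ⟩ := Metric.continuousWithinAt_iff.1 hcont (‖leftMellin φ (ρ - 1)‖ / 2)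
    (by positivity)
  set b : ℝ := ‖leftMellin φ (ρ - 1)‖ / 2 with hb
  set L : ℝ := ‖ρ - 1‖ + 1 with hL
  have hbpos : 0 < b := by rw [hb]; positivity
  have hLpos : 0 < L := by rw [hL]; positivity
  have key : ∀ h : ℝ, 0 < h → h < min δ (min (1 / 2) r) → b ≤ M * L * K * h ^ (1 / 2 : ℝ) := by
    intro h hh0 hh1
    have hhδ : h < δ := lt_of_lt_of_le hh1 (min_le_left _ _)
    have hh2 : h < 1 / 2 := lt_of_lt_of_le hh1 ((min_le_right _ _).trans (min_le_left _ _))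
    have hhr : h < r := lt_of_lt_of_le hh1 ((min_le_right _ _).trans (min_le_right _ _))
    have hsre : (ρ - 1 + h).re = -(1 / 2 : ℝ) + h := by
      rw [Complex.add_re, hs₀re, Complex.ofReal_re]
    have hs1 : -(1 / 2 : ℝ) < (ρ - 1 + h).re := by rw [hsre]; linarith
    have hs2 : (ρ - 1 + h).re < 0 := by rw [hsre]; linarith
    have h3 := h311 _ hs1 hs2
    have hsζ : ρ - 1 + (h : ℂ) + 1 = ρ + h := by ring
    rw [hsζ] at h3
    have hbs : b ≤ ‖leftMellin φ (ρ - 1 + h)‖ := by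
      have hd : dist (ρ - 1 + (h : ℂ)) (ρ - 1) < δ := by
        rw [dist_eq_norm, add_sub_cancel_left, Complex.norm_real, Real.norm_of_nonneg hh0.le]
        exact hhδ
      have h1 := hδ ⟨hs1.le, hs2.le⟩ hd
      rw [dist_eq_norm] at h1
      have h2 := norm_sub_norm_le (leftMellin φ (ρ - 1)) (leftMellin φ (ρ - 1 + h))
      rw [norm_sub_rev] at h2
      rw [hb]
      linarith
    have hMG : ‖leftMellin G (ρ - 1 + h)‖ ≤ M * h ^ (-(1 / 2 : ℝ)) := by
      have h1 := norm_leftMellin_le (f := G) (ρ - 1 + h)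
      rw [hsre] at h1
      exact h1.trans (hNG h hh0 hh2).2
    have hsL : ‖ρ - 1 + (h : ℂ)‖ ≤ L := by
      rw [hL]
      calc ‖ρ - 1 + (h : ℂ)‖ ≤ ‖ρ - 1‖ + ‖(h : ℂ)‖ := norm_add_le _ _
        _ ≤ ‖ρ - 1‖ + 1 := by
            rw [Complex.norm_real, Real.norm_of_nonneg hh0.le]; linarith
    have hup : ‖leftMellin φ (ρ - 1 + h)‖ ≤ M * h ^ (-(1 / 2 : ℝ)) * (L * (K * h)) := by
      rw [← h3, norm_mul, norm_mul]
      exact mul_le_mul hMG (mul_le_mul hsL (hζK h hh0 hhr) (norm_nonneg _) hLpos.le)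
        (mul_nonneg (norm_nonneg _) (norm_nonneg _)) (by positivity)
    have hpow : h ^ (-(1 / 2 : ℝ)) * h = h ^ (1 / 2 : ℝ) := by
      conv_lhs => rw [show h = h ^ (1 : ℝ) by rw [Real.rpow_one]]
      rw [Real.rpow_one, ← Real.rpow_add_one' hh0.le (by norm_num)]
      norm_num
    calc b ≤ ‖leftMellin φ (ρ - 1 + h)‖ := hbs
      _ ≤ M * h ^ (-(1 / 2 : ℝ)) * (L * (K * h)) := hup
      _ = M * L * K * (h ^ (-(1 / 2 : ℝ)) * h) := by ring
      _ = M * L * K * h ^ (1 / 2 : ℝ) := by rw [hpow]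
  have hlim : Tendsto (fun h : ℝ => M * L * K * h ^ (1 / 2 : ℝ)) (𝓝[>] 0) (𝓝 (M * L * K * 0)) := by
    have hc : Tendsto (fun h : ℝ => h ^ (1 / 2 : ℝ)) (𝓝[>] 0) (𝓝 0) := by
      have := (Real.continuousAt_rpow_const (0 : ℝ) (1 / 2) (Or.inr (by norm_num))).tendsto
      rw [Real.zero_rpow (by norm_num)] at this
      exact this.mono_left nhdsWithin_le_nhds
    exact hc.const_mul _
  rw [mul_zero] at hlim
  have hev : ∀ᶠ h in 𝓝[>] (0 : ℝ), b ≤ M * L * K * h ^ (1 / 2 : ℝ) := by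
    filter_upwards [Ioo_mem_nhdsGT (show (0 : ℝ) < min δ (min (1 / 2) r) by positivity)] with h hh
    exact key h hh.1 hh.2
  have := ge_of_tendsto hlim hev
  linarith

/-! ## Theorems 2.3 and 4.2 as printed (both clauses), and the sign-change remark of §4 -/

open BaezDuarteMellin in
/-- **Báez-Duarte 2005, Theorem 2.3 AS PRINTED** (IJMMS p. 3602, (2.14) = arXiv Thm. 2.2 (2.9)):
"With `g₁(x) := x⁻¹g(x⁻¹)`, `RH ⟺ (‖g₁‖_p < ∞, ∀p ∈ [1,2))`, and, unconditionally, `‖g₁‖₂ = ∞`" —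
both clauses, `‖g₁‖_p < ∞` rendered as integrability of `|g₁|^p` on `(0,∞)`
(`BaezDuarte2005Moebius_thm_2_3` + `BaezDuarte2005Moebius_thm_2_3_normSq`). An equivalence and an
unconditional divergence; nothing here bears on the truth of RH.
[cite: BaezDuarte2005Moebius, Thm. 2.3 (2.14) (IJMMS 2005:22 p. 3602; arXiv Thm. 2.2)] -/
theorem BaezDuarte2005Moebius_thm_2_3_asPrinted :
    (RiemannHypothesis ↔ ∀ p : ℝ, 1 ≤ p → p < 2 →
        IntegrableOn (fun x : ℝ ↦ |x⁻¹ * moebiusDivSum x⁻¹| ^ p) (Ioi 0)) ∧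
      ¬ IntegrableOn (fun x : ℝ ↦ |x⁻¹ * moebiusDivSum x⁻¹| ^ (2 : ℝ)) (Ioi 0) :=
  ⟨BaezDuarte2005Moebius_thm_2_3, BaezDuarte2005Moebius_thm_2_3_normSq⟩

open BaezDuarteMellin in
/-- **Báez-Duarte 2005, Theorem 4.2 AS PRINTED** (IJMMS pp. 3605–3606, (4.4)–(4.6)): "Let `φ` be
Mellin-proper, `ψ(x) := x⁻¹Gφ(x⁻¹)`; then `RH ⟺ (‖ψ‖_p < ∞, ∀p ∈ [1,2))`. Furthermore,
unconditionally on RH, if `φ^∧(s) ∈ A[−1/2,0)` does not vanish on the line `σ = −1/2`, then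
`‖ψ‖₂ = ∞`" — both clauses (`BaezDuarte2005Moebius_thm_4_2` + `BaezDuarte2005Moebius_thm_4_2_normSq`;
the continuity `φ^∧ ∈ A^c[−1/2,0]` is supplied by `N_{−1/2}(φ) < ∞`). Nothing here bears on the
truth of RH. [cite: BaezDuarte2005Moebius, Thm. 4.2 (4.4)–(4.6) (IJMMS 2005:22 pp. 3605–3606)] -/
theorem BaezDuarte2005Moebius_thm_4_2_asPrinted {φ : ℝ → ℂ} (hφ : IsMellinProper φ) :
    (RiemannHypothesis ↔ ∀ p : ℝ, 1 ≤ p → p < 2 →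
        IntegrableOn (fun x : ℝ ↦ ‖(x : ℂ)⁻¹ * moebiusConv φ x⁻¹‖ ^ p) (Ioi 0)) ∧
      (HasFiniteMellinNorm φ (-(1 / 2 : ℝ)) → (∀ s : ℂ, s.re = -(1 / 2 : ℝ) → leftMellin φ s ≠ 0) →
        ¬ IntegrableOn (fun x : ℝ ↦ ‖(x : ℂ)⁻¹ * moebiusConv φ x⁻¹‖ ^ (2 : ℝ)) (Ioi 0)) :=
  ⟨BaezDuarte2005Moebius_thm_4_2 hφ, fun hN hne => BaezDuarte2005Moebius_thm_4_2_normSq hφ hN hne⟩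

open BaezDuarteMellin in
/-- **The sign-change remark (IJMMS p. 3607)**: "If `φ ∈ L¹(ℝ×)` is real, and `∫₀^∞ φ(t) t⁻¹ dt = 0`,
then `∫₀^∞ Gφ(t) t⁻¹ dt = 0` by (3.11), so, unless `Gφ ≡ 0`, there must be at least one change of
sign in `x > 0`." Here: for real proper `φ` with `∫₀^∞ φ dx/x = 0`, if `Gφ` is not a.e. zero on
`(0,∞)` then `Gφ` takes a positive value and a negative value on `(0,∞)`.
[cite: BaezDuarte2005Moebius, §4 p. 3607 (sign-change remark after (4.13)) and Lemma 3.2 (3.11)] -/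
theorem BaezDuarte2005Moebius_signChange {φ : ℝ → ℂ} (hφ : IsMoebiusProper φ)
    (hreal : ∀ u : ℝ, 0 < u → (φ u).im = 0) (hmean : ∫ x in Ioi (0 : ℝ), φ x / x = 0)
    (hne : ¬ (∀ᵐ x ∂(volume.restrict (Ioi (0 : ℝ))), moebiusConv φ x = 0)) :
    (∃ x : ℝ, 0 < x ∧ 0 < (moebiusConv φ x).re) ∧ (∃ x : ℝ, 0 < x ∧ (moebiusConv φ x).re < 0) := by
  have hφm : Measurable φ := hφ.1
  set G : ℝ → ℂ := moebiusConv φ with hGdef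
  have hGm : Measurable G := measurable_moebiusConv hφm
  -- `∫₀^∞ Gφ dx/x = 0` by (3.11)
  have hG : ∫ x in Ioi (0 : ℝ), G x / x = 0 := by rw [hGdef, integral_moebiusConv_div_eq hφ, hmean]
  -- `Gφ` is real and `Gφ/x` is integrable on `(0,∞)`
  have him : ∀ x : ℝ, (G x).im = 0 := by
    intro x
    rw [hGdef]
    unfold moebiusConv
    by_cases hint : Integrable (fun t : ℝ => (moebiusDivSum (x * t) : ℂ) * φ (1 / t) / t)
        (volume.restrict (Ioi (0 : ℝ)))
    · have h := integral_im hint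
      rw [← RCLike.im_to_complex, ← h]
      refine setIntegral_eq_zero_of_forall_eq_zero fun t ht => ?_
      have ht0 : (0 : ℝ) < t := ht
      simp only [RCLike.im_to_complex, Complex.div_ofReal_im, Complex.mul_im, Complex.ofReal_re,
        Complex.ofReal_im, zero_mul, add_zero, hreal (1 / t) (by positivity), mul_zero, zero_div]
    · rw [integral_undef hint, Complex.zero_im]
  have hG0 := hasFiniteMellinNorm_moebiusConv_zero hφ
  unfold HasFiniteMellinNorm at hG0
  have hIG : Integrable (fun x : ℝ => G x / x) (volume.restrict (Ioi (0 : ℝ))) := by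
    refine hG0.mono' (hGm.div (Complex.measurable_ofReal.comp measurable_id)).aestronglyMeasurable ?_
    refine ae_restrict_of_forall_mem measurableSet_Ioi fun x hx => ?_
    have hx0 : (0 : ℝ) < x := hx
    rw [norm_div, Complex.norm_real, Real.norm_of_nonneg hx0.le, show -(0 : ℝ) - 1 = -1 by norm_num,
      Real.rpow_neg_one, div_eq_inv_mul]
  have hre_int : ∫ x in Ioi (0 : ℝ), (G x / x).re = 0 := by
    have h := integral_re hIG
    rw [hG] at h
    simpa using h
  have hre_div : ∀ x : ℝ, 0 < x → (G x / (x : ℂ)).re = (G x).re / x := by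
    intro x hx
    rw [Complex.div_ofReal_re]
  -- if `Re Gφ` had a sign on `(0,∞)`, it would vanish a.e.
  have key : ∀ η : ℝ, (η = 1 ∨ η = -1) → (∀ x : ℝ, 0 < x → 0 ≤ η * (G x).re) →
      ∀ᵐ x ∂(volume.restrict (Ioi (0 : ℝ))), G x = 0 := by
    intro η hη hsign
    have hηsq : η * η = 1 := by rcases hη with rfl | rfl <;> norm_num
    have hI : Integrable (fun x : ℝ => η * (G x / x).re) (volume.restrict (Ioi (0 : ℝ))) :=
      (hIG.re).const_mul η
    have hnonneg : 0 ≤ᵐ[volume.restrict (Ioi (0 : ℝ))] fun x : ℝ => η * (G x / x).re := by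
      refine ae_restrict_of_forall_mem measurableSet_Ioi fun x hx => ?_
      have hx0 : (0 : ℝ) < x := hx
      show (0 : ℝ) ≤ η * (G x / (x : ℂ)).re
      rw [hre_div x hx0, show η * ((G x).re / x) = η * (G x).re / x by ring]
      exact div_nonneg (hsign x hx0) hx0.le
    have hzero : ∫ x in Ioi (0 : ℝ), η * (G x / x).re = 0 := by
      rw [integral_const_mul, hre_int, mul_zero]
    have hae := (integral_eq_zero_iff_of_nonneg_ae hnonneg hI).1 hzero
    filter_upwards [hae, ae_restrict_mem measurableSet_Ioi] with x hx hx0'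
    have hx0 : (0 : ℝ) < x := hx0'
    have h1 : η * (G x / x).re = 0 := hx
    rw [hre_div x hx0] at h1
    have h2 : (G x).re = 0 := by
      have h3 : η * (G x).re = 0 := by
        have := mul_eq_zero.1 h1
        rcases this with h | h
        · rcases hη with rfl | rfl <;> norm_num at h
        · rcases div_eq_zero_iff.1 h with h' | h'
          · rcases mul_eq_zero.1 (show η * (G x).re = 0 by
              rcases hη with rfl | rfl <;> simp [h']) with h4 | h4
            · rcases hη with rfl | rfl <;> norm_num at h4
            · simpa using (show η * (G x).re = 0 by rw [h4, mul_zero])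
          · exact absurd h' hx0.ne'
      rcases mul_eq_zero.1 h3 with h | h
      · rcases hη with rfl | rfl <;> norm_num at h
      · exact h
    exact Complex.ext (by simpa using h2) (by simpa using him x)
  constructor
  · by_contra h
    push Not at h
    exact hne (key (-1) (Or.inr rfl) fun x hx => by have := h x hx; linarith)
  · by_contra h
    push Not at h
    exact hne (key 1 (Or.inl rfl) fun x hx => by have := h x hx; linarith)

/-! ## `H` has infinitely many positive zeros (IJMMS §1) -/

/-- **The Hardy–Littlewood function has infinitely many positive real zeros** (IJMMS §1, p. 3600:
"it is shown that both [`R` and `H`] have an infinite number of positive, real zeros"), here for `H`,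
unconditionally: beyond every `X` there is a zero of `H` (sign changes beyond every bound +
continuity of `H` + the intermediate value theorem), and the set of positive zeros is infinite.
[cite: BaezDuarte2005Moebius, §1 p. 3600 ("an infinite number of positive, real zeros")] -/
theorem hardyLittlewoodFunction_exists_zero_gt (X : ℝ) :
    ∃ y : ℝ, X < y ∧ hardyLittlewoodFunction y = 0 := by
  obtain ⟨hpos, hneg⟩ := hardyLittlewoodFunction_frequently_pos_and_neg
  obtain ⟨y₁, hy₁, h₁⟩ := hpos.forall_exists_of_atTop (X + 1)
  obtain ⟨y₂, hy₂, h₂⟩ := hneg.forall_exists_of_atTop y₁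
  have hivt := intermediate_value_Icc' hy₂ continuous_hardyLittlewoodFunction.continuousOn
  obtain ⟨c, hc, hc0⟩ := hivt ⟨h₂.le, h₁.le⟩
  exact ⟨c, by linarith [hc.1], hc0⟩

/-- The set of positive real zeros of `H` is infinite. [cite: BaezDuarte2005Moebius, §1 p. 3600] -/
theorem hardyLittlewoodFunction_zeros_infinite :
    {y : ℝ | 0 < y ∧ hardyLittlewoodFunction y = 0}.Infinite := by
  refine Set.infinite_of_forall_exists_gt fun a => ?_
  obtain ⟨y, hy, hy0⟩ := hardyLittlewoodFunction_exists_zero_gt (max a 0)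
  exact ⟨y, ⟨lt_of_le_of_lt (le_max_right _ _) hy, hy0⟩, lt_of_le_of_lt (le_max_left _ _) hy⟩

/-! ## Riesz's test function `α(x) = x(1 − 2x²)e^{−x²}` is Mellin-proper (IJMMS p. 3604) -/

namespace BaezDuarteMellin

/-- All weighted norms `N_σ(α)`, `σ < 1`, of Riesz's test function `α(x) = x(1 − 2x²)e^{−x²}` are
finite (`|α(x)| ≤ (x + 2x³)e^{−x²}`). [cite: BaezDuarte2005Moebius, §3.1 (3.7) ("both α and β are Mellin-proper"), (1.2) (Riesz's α)] -/
theorem hasFiniteMellinNorm_hlAlpha {σ : ℝ} (hσ : σ < 1) :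
    HasFiniteMellinNorm (fun u : ℝ ↦ (((u * (1 - 2 * u ^ 2) * Real.exp (-u ^ 2)) : ℝ) : ℂ)) σ := by
  unfold HasFiniteMellinNorm
  have h1 : IntegrableOn (fun x : ℝ ↦ x ^ (-σ) * Real.exp (-1 * x ^ 2)) (Ioi 0) :=
    integrableOn_rpow_mul_exp_neg_mul_sq one_pos (by linarith : (-1 : ℝ) < -σ)
  have h2 : IntegrableOn (fun x : ℝ ↦ x ^ (2 - σ) * Real.exp (-1 * x ^ 2)) (Ioi 0) :=
    integrableOn_rpow_mul_exp_neg_mul_sq one_pos (by linarith : (-1 : ℝ) < 2 - σ)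
  have hmaj : IntegrableOn (fun x : ℝ ↦ x ^ (-σ) * Real.exp (-1 * x ^ 2) +
      2 * (x ^ (2 - σ) * Real.exp (-1 * x ^ 2))) (Ioi 0) := h1.add (h2.const_mul 2)
  have hmeas : Measurable fun u : ℝ ↦
      u ^ (-σ - 1) * ‖(((u * (1 - 2 * u ^ 2) * Real.exp (-u ^ 2)) : ℝ) : ℂ)‖ :=
    (measurable_id.pow_const _).mul (Complex.measurable_ofReal.comp (((measurable_id.mul
      (measurable_const.sub ((measurable_id.pow_const 2).const_mul 2))).mul
      (Real.measurable_exp.comp (measurable_id.pow_const 2).neg)))).norm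
  refine Integrable.mono' hmaj hmeas.aestronglyMeasurable ?_
  refine ae_restrict_of_forall_mem measurableSet_Ioi fun u hu ↦ ?_
  have hu0 : (0 : ℝ) < u := hu
  rw [Real.norm_eq_abs, abs_of_nonneg (mul_nonneg (Real.rpow_nonneg hu0.le _) (norm_nonneg _)),
    Complex.norm_real, Real.norm_eq_abs]
  have hab : |u * (1 - 2 * u ^ 2) * Real.exp (-u ^ 2)| ≤ (u + 2 * u ^ 3) * Real.exp (-u ^ 2) := by
    rw [abs_mul, abs_mul, abs_of_pos hu0, Real.abs_exp]
    have h3 : |1 - 2 * u ^ 2| ≤ 1 + 2 * u ^ 2 := by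
      refine abs_le.2 ⟨?_, ?_⟩ <;> nlinarith [sq_nonneg u]
    calc u * |1 - 2 * u ^ 2| * Real.exp (-u ^ 2) ≤ u * (1 + 2 * u ^ 2) * Real.exp (-u ^ 2) := by
          gcongr
      _ = (u + 2 * u ^ 3) * Real.exp (-u ^ 2) := by ring
  have hp1 : u ^ (-σ - 1) * u = u ^ (-σ) := by
    conv_lhs => rw [show u = u ^ (1 : ℝ) by rw [Real.rpow_one]]
    rw [Real.rpow_one, ← Real.rpow_add_one hu0.ne']
    ring_nf
  have hp3 : u ^ (-σ - 1) * u ^ 3 = u ^ (2 - σ) := by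
    rw [← Real.rpow_natCast u 3, ← Real.rpow_add hu0]
    norm_num
    ring_nf
  calc u ^ (-σ - 1) * |u * (1 - 2 * u ^ 2) * Real.exp (-u ^ 2)|
      ≤ u ^ (-σ - 1) * ((u + 2 * u ^ 3) * Real.exp (-u ^ 2)) :=
        mul_le_mul_of_nonneg_left hab (Real.rpow_nonneg hu0.le _)
    _ = u ^ (-σ) * Real.exp (-1 * u ^ 2) + 2 * (u ^ (2 - σ) * Real.exp (-1 * u ^ 2)) := by
        rw [show (-1 : ℝ) * u ^ 2 = -u ^ 2 by ring, ← hp1, ← hp3]; ring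

/-- **`α^∧(s) = (s/2)·Γ((1 − s)/2)` for `Re s < 1`** (`α(x) = x(1 − 2x²)e^{−x²} = −β(x)/(2x) + xβ(x)`,
so `α^∧(s) = −½β^∧(s+1) + β^∧(s−1) = ½Γ((1−s)/2) − Γ((3−s)/2)`): the computation behind "both `α`
and `β` are Mellin-proper". In particular `α^∧` vanishes only at `s = 0` in `Re s < 1`.
[cite: BaezDuarte2005Moebius, §3.1 (3.7) and p. 3604 (α Mellin-proper)] -/
theorem leftMellin_hlAlpha {s : ℂ} (hs : s.re < 1) :
    leftMellin (fun u : ℝ ↦ (((u * (1 - 2 * u ^ 2) * Real.exp (-u ^ 2)) : ℝ) : ℂ)) s =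
      s / 2 * Complex.Gamma ((1 - s) / 2) := by
  set β : ℝ → ℂ := fun u : ℝ ↦ (((-2 * u ^ 2 * Real.exp (-u ^ 2)) : ℝ) : ℂ) with hβ
  have hβm : Measurable β := Complex.measurable_ofReal.comp
    ((((measurable_id.pow_const 2).const_mul (-2))).mul
      (Real.measurable_exp.comp (measurable_id.pow_const 2).neg))
  have hI1 : IntegrableOn (fun x : ℝ => (x : ℂ) ^ (-(s + 1) - 1) * β x) (Ioi 0) :=
    integrableOn_cpow_mul hβm (hasFiniteMellinNorm_hlBeta (by
      simp only [Complex.add_re, Complex.one_re]; linarith))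
  have hI2 : IntegrableOn (fun x : ℝ => (x : ℂ) ^ (-(s - 1) - 1) * β x) (Ioi 0) :=
    integrableOn_cpow_mul hβm (hasFiniteMellinNorm_hlBeta (by
      simp only [Complex.sub_re, Complex.one_re]; linarith))
  have hpt : ∀ x ∈ Ioi (0 : ℝ),
      (x : ℂ) ^ (-s - 1) * (((x * (1 - 2 * x ^ 2) * Real.exp (-x ^ 2)) : ℝ) : ℂ) =
        -(1 / 2) * ((x : ℂ) ^ (-(s + 1) - 1) * β x) + (x : ℂ) ^ (-(s - 1) - 1) * β x := by
    intro x hx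
    have hx0 : (0 : ℝ) < x := hx
    have hx' : (x : ℂ) ≠ 0 := Complex.ofReal_ne_zero.2 hx0.ne'
    have e1 : (x : ℂ) ^ (-(s + 1) - 1) = (x : ℂ) ^ (-s - 1) * (x : ℂ)⁻¹ := by
      rw [show -(s + 1) - 1 = (-s - 1) + (-1) by ring, Complex.cpow_add _ _ hx',
        Complex.cpow_neg_one]
    have e2 : (x : ℂ) ^ (-(s - 1) - 1) = (x : ℂ) ^ (-s - 1) * (x : ℂ) := by
      rw [show -(s - 1) - 1 = (-s - 1) + 1 by ring, Complex.cpow_add _ _ hx', Complex.cpow_one]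
    rw [e1, e2, hβ]
    push_cast
    field_simp
    ring
  unfold leftMellin
  rw [setIntegral_congr_fun measurableSet_Ioi hpt, integral_add (hI1.const_mul _) hI2,
    integral_const_mul]
  have h1 : ∫ x in Ioi (0 : ℝ), (x : ℂ) ^ (-(s + 1) - 1) * β x = -Complex.Gamma (1 - (s + 1) / 2) :=
    leftMellin_hlBeta (by simp only [Complex.add_re, Complex.one_re]; linarith)
  have h2 : ∫ x in Ioi (0 : ℝ), (x : ℂ) ^ (-(s - 1) - 1) * β x = -Complex.Gamma (1 - (s - 1) / 2) :=
    leftMellin_hlBeta (by simp only [Complex.sub_re, Complex.one_re]; linarith)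
  rw [h1, h2]
  have hne : (1 - s) / 2 ≠ 0 := by
    intro h
    have := congrArg Complex.re h
    simp only [Complex.div_ofNat_re, Complex.sub_re, Complex.one_re, Complex.zero_re] at this
    linarith
  have hG : Complex.Gamma (1 - (s - 1) / 2) = (1 - s) / 2 * Complex.Gamma ((1 - s) / 2) := by
    rw [show 1 - (s - 1) / 2 = (1 - s) / 2 + 1 by ring, Complex.Gamma_add_one _ hne]
  rw [hG, show 1 - (s + 1) / 2 = (1 - s) / 2 by ring]
  ring

/-- **Riesz's test function `α(x) = x(1 − 2x²)e^{−x²}` is Mellin-proper** (IJMMS p. 3604: "It is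
quite easy to see that both `α` and `β` are Mellin-proper"): `N_σ(α) < ∞` for all `σ < 1` and
`α^∧(s) = (s/2)Γ((1−s)/2) ≠ 0` for `s ≠ 0`, `Re s < 1`. (With (3.7) `x⁻¹R(x²) = Gα(x)`,
`moebiusConv_hlAlpha_eq`, Theorems 3.5/4.1/4.4 then apply to Riesz's function `R`.)
[cite: BaezDuarte2005Moebius, §3.1 p. 3604 (α Mellin-proper), (1.2)] -/
theorem isMellinProper_hlAlpha :
    IsMellinProper (fun u : ℝ ↦ (((u * (1 - 2 * u ^ 2) * Real.exp (-u ^ 2)) : ℝ) : ℂ)) := by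
  refine ⟨⟨Complex.measurable_ofReal.comp (((measurable_id.mul
      (measurable_const.sub ((measurable_id.pow_const 2).const_mul 2))).mul
      (Real.measurable_exp.comp (measurable_id.pow_const 2).neg))),
    fun σ _ h2 => hasFiniteMellinNorm_hlAlpha (by linarith)⟩, fun s _ h2 => ?_⟩
  rw [leftMellin_hlAlpha (by linarith)]
  refine mul_ne_zero (div_ne_zero ?_ two_ne_zero) (Complex.Gamma_ne_zero_of_re_pos ?_)
  · intro h; rw [h, Complex.zero_re] at h2; exact lt_irrefl _ h2
  · simp only [Complex.div_ofNat_re, Complex.sub_re, Complex.one_re]; linarith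

/-- `α^∧` does not vanish on the line `Re s = −1/2` (indeed on `Re s < 1`, `s ≠ 0`).
[cite: BaezDuarte2005Moebius, §3.1 p. 3604, Thm. 4.1 hypotheses for α] -/
theorem leftMellin_hlAlpha_ne_zero {s : ℂ} (hs : s.re < 1) (hs0 : s ≠ 0) :
    leftMellin (fun u : ℝ ↦ (((u * (1 - 2 * u ^ 2) * Real.exp (-u ^ 2)) : ℝ) : ℂ)) s ≠ 0 := by
  rw [leftMellin_hlAlpha hs]
  refine mul_ne_zero (div_ne_zero hs0 two_ne_zero) (Complex.Gamma_ne_zero_of_re_pos ?_)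
  simp only [Complex.div_ofNat_re, Complex.sub_re, Complex.one_re]; linarith

/-- **Báez-Duarte's (3.7) for Riesz's function: `x⁻¹R(x²) = Gα(x)`** for `x > 0`,
`α(u) = u(1 − 2u²)e^{−u²}`. With `w(t) = (x/t)e^{−x²/t²}`: `x⁻¹R(x²) = Σ_n w(n) μ(n)/n`
(`R(y) = Σ_n μ(n)(y/n²)e^{−y/n²}`, tree: `rieszFunction_eq_tsum_moebius`), Abel summation gives
`x⁻¹R(x²) = −∫₁^∞ w'(t) g(t) dt`, and after `u = xt`, `Gα(x) = ∫₀^∞ g(u) α(x/u) du/u` has the same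
integrand since `α(x/u)/u = −w'(u)`. [cite: BaezDuarte2005Moebius, §3.1 eq. (3.7) (x⁻¹R(x²) = Gα(x)) and (1.2)] -/
theorem moebiusConv_hlAlpha_eq {x : ℝ} (hx : 0 < x) :
    moebiusConv (fun u : ℝ ↦ (((u * (1 - 2 * u ^ 2) * Real.exp (-u ^ 2)) : ℝ) : ℂ)) x =
      ((rieszFunction (x ^ 2) / x : ℝ) : ℂ) := by
  set X : ℝ := x ^ 2 with hXdef
  have hX : 0 < X := by positivity
  obtain ⟨B, hB, hgB⟩ := exists_abs_moebiusDivSum_le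
  -- the Abel weight `w(t) = (x/t) e^{−X/t²}` and its derivative
  set w : ℝ → ℝ := fun t ↦ x * t⁻¹ * Real.exp (-(X / t ^ 2)) with hw
  set Dw : ℝ → ℝ := fun t ↦ x * (-(t ^ 2)⁻¹) * Real.exp (-(X / t ^ 2)) +
    x * t⁻¹ * (Real.exp (-(X / t ^ 2)) * (2 * X / t ^ 3)) with hDw
  have hwd : ∀ t : ℝ, t ≠ 0 → HasDerivAt w (Dw t) t := by
    intro t ht
    have h1 : HasDerivAt (fun t : ℝ ↦ x * t⁻¹) (x * (-(t ^ 2)⁻¹)) t := (hasDerivAt_inv ht).const_mul x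
    have h2 : HasDerivAt (fun t : ℝ ↦ Real.exp (-(X / t ^ 2))) (Real.exp (-(X / t ^ 2)) * (2 * X / t ^ 3)) t := by
      simpa using (hasDerivAt_hlWeight X ht).add_const 1
    exact h1.mul h2
  have hderiv : ∀ t : ℝ, t ≠ 0 → deriv w t = Dw t := fun t ht ↦ (hwd t ht).deriv
  set c : ℕ → ℝ := fun k ↦ ((ArithmeticFunction.moebius k : ℤ) : ℝ) / k with hc
  set G : ℝ → ℝ := fun u ↦ deriv w u * ∑ k ∈ Finset.Icc 0 ⌊u⌋₊, c k with hG
  have hc0 : c 0 = 0 := by simp [hc]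
  have hcS : ∀ t : ℝ, ∑ k ∈ Finset.Icc 0 ⌊t⌋₊, c k = moebiusDivSum t := fun t ↦ by
    rw [moebiusDivSum_eq_sum_range, Nat.range_succ_eq_Icc_zero]
  have hc1 : ∀ n : ℕ, |c n| ≤ 1 / n := fun n ↦ by
    simp only [hc]
    rcases Nat.eq_zero_or_pos n with rfl | hn
    · simp
    · rw [abs_div, Nat.abs_cast]
      have hμ : |((ArithmeticFunction.moebius n : ℤ) : ℝ)| ≤ 1 := by
        exact_mod_cast ArithmeticFunction.abs_moebius_le_one
      exact div_le_div_of_nonneg_right hμ (by positivity)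
  -- Step 1: `x⁻¹ R(X) = Σ_n w(n) c(n)`
  have hw_abs : ∀ n : ℕ, |w n| ≤ x := fun n ↦ by
    simp only [hw]
    rcases Nat.eq_zero_or_pos n with rfl | hn
    · simp [hx.le]
    · have hn1 : (1 : ℝ) ≤ n := by exact_mod_cast hn
      rw [abs_mul, abs_mul, abs_of_pos hx, Real.abs_exp, abs_of_pos (by positivity)]
      have he : Real.exp (-(X / (n : ℝ) ^ 2)) ≤ 1 := Real.exp_le_one_iff.2 (by
        have : 0 ≤ X / (n : ℝ) ^ 2 := by positivity
        linarith)
      have hi : (n : ℝ)⁻¹ ≤ 1 := inv_le_one_of_one_le₀ hn1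
      calc x * (n : ℝ)⁻¹ * Real.exp (-(X / (n : ℝ) ^ 2)) ≤ x * 1 * 1 := by gcongr
        _ = x := by ring
  have hsumm : Summable fun n : ℕ ↦ w n * c n := by
    refine Summable.of_norm_bounded (g := fun n : ℕ ↦ x * (1 / (n : ℝ) ^ 2))
      ((Real.summable_one_div_nat_pow.2 one_lt_two).mul_left x) fun n ↦ ?_
    rw [Real.norm_eq_abs, abs_mul]
    rcases Nat.eq_zero_or_pos n with rfl | hn
    · simp [hc]
    · have hn0 : (0 : ℝ) < n := by exact_mod_cast hn
      simp only [hw]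
      rw [abs_mul, abs_mul, abs_of_pos hx, Real.abs_exp, abs_of_pos (by positivity : (0 : ℝ) < (n : ℝ)⁻¹)]
      have he : Real.exp (-(X / (n : ℝ) ^ 2)) ≤ 1 := Real.exp_le_one_iff.2 (by
        have : 0 ≤ X / (n : ℝ) ^ 2 := by positivity
        linarith)
      calc x * (n : ℝ)⁻¹ * Real.exp (-(X / (n : ℝ) ^ 2)) * |c n| ≤ x * (n : ℝ)⁻¹ * 1 * (1 / n) := by
            gcongr
            exact hc1 n
        _ = x * (1 / (n : ℝ) ^ 2) := by field_simp
  have hF : rieszFunction X / x = ∑' n : ℕ, w n * c n := by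
    have h := rieszFunction_eq_tsum_moebius X
    have h2 : ((∑' n : ℕ, w n * c n : ℝ) : ℂ) = (x : ℂ)⁻¹ * ∑' n : ℕ, ((ArithmeticFunction.moebius n : ℤ) : ℂ) *
        (((X / (n : ℝ) ^ 2 * Real.exp (-(X / (n : ℝ) ^ 2)) : ℝ) : ℂ)) := by
      rw [Complex.ofReal_tsum, ← tsum_mul_left]
      refine tsum_congr fun n ↦ ?_
      simp only [hw, hc]
      rcases Nat.eq_zero_or_pos n with rfl | hn
      · simp
      · have hn0 : (n : ℂ) ≠ 0 := by exact_mod_cast hn.ne'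
        have hx' : (x : ℂ) ≠ 0 := Complex.ofReal_ne_zero.2 hx.ne'
        rw [hXdef]
        push_cast
        field_simp
    have h3 : ((rieszFunction X / x : ℝ) : ℂ) = ((∑' n : ℕ, w n * c n : ℝ) : ℂ) := by
      rw [h2, ← h]
      push_cast
      rw [div_eq_inv_mul]
    exact_mod_cast h3
  -- Step 2: Abel summation `Σ w(n)c(n) = −∫₁^∞ w' g`
  have hf_diff : ∀ t ∈ Set.Ici (1 : ℝ), DifferentiableAt ℝ w t := fun t ht ↦
    (hwd t (by linarith [Set.mem_Ici.1 ht] : t ≠ 0)).differentiableAt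
  have hexpc : ContinuousOn (fun t : ℝ ↦ Real.exp (-(X / t ^ 2))) (Set.Ici 1) := by
    have hne : ∀ t ∈ Set.Ici (1 : ℝ), t ≠ 0 := fun t ht ↦ by linarith [Set.mem_Ici.1 ht]
    refine Real.continuous_exp.comp_continuousOn (ContinuousOn.neg ?_)
    exact continuousOn_const.div (continuousOn_pow 2) fun t ht ↦ pow_ne_zero 2 (hne t ht)
  have hcont : ContinuousOn Dw (Set.Ici 1) := by
    have hne : ∀ t ∈ Set.Ici (1 : ℝ), t ≠ 0 := fun t ht ↦ by linarith [Set.mem_Ici.1 ht]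
    refine ContinuousOn.add ?_ ?_
    · refine (continuousOn_const.mul ?_).mul hexpc
      exact ((continuousOn_pow 2).inv₀ fun t ht ↦ pow_ne_zero 2 (hne t ht)).neg
    · refine (continuousOn_const.mul (continuousOn_inv₀.mono fun t ht ↦ hne t ht)).mul
        (hexpc.mul ?_)
      exact continuousOn_const.div (continuousOn_pow 3) fun t ht ↦ pow_ne_zero 3 (hne t ht)
  have hf_int : LocallyIntegrableOn (deriv w) (Set.Ici 1) := by
    refine (hcont.congr fun t ht ↦ hderiv t ?_).locallyIntegrableOn measurableSet_Ici
    linarith [Set.mem_Ici.1 ht]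
  have h_lim : Tendsto (fun n : ℕ ↦ w n * ∑ k ∈ Finset.Icc 0 n, c k) atTop (𝓝 0) := by
    have hlim : Tendsto (fun n : ℕ ↦ B * x / (n : ℝ)) atTop (𝓝 0) :=
      tendsto_const_div_atTop_nhds_zero_nat (B * x)
    refine squeeze_zero_norm' ?_ hlim
    filter_upwards [eventually_ge_atTop 1] with n hn
    have hn0 : (0 : ℝ) < n := by exact_mod_cast hn
    have hS : |∑ k ∈ Finset.Icc 0 n, c k| ≤ B := by
      have := hcS n
      rw [Nat.floor_natCast] at this
      rw [this]
      exact hgB n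
    have hwn : |w n| ≤ x / n := by
      simp only [hw]
      rw [abs_mul, abs_mul, abs_of_pos hx, Real.abs_exp, abs_of_pos (by positivity : (0 : ℝ) < (n : ℝ)⁻¹)]
      have he : Real.exp (-(X / (n : ℝ) ^ 2)) ≤ 1 := Real.exp_le_one_iff.2 (by
        have : 0 ≤ X / (n : ℝ) ^ 2 := by positivity
        linarith)
      calc x * (n : ℝ)⁻¹ * Real.exp (-(X / (n : ℝ) ^ 2)) ≤ x * (n : ℝ)⁻¹ * 1 := by gcongr
        _ = x / n := by rw [mul_one, div_eq_mul_inv]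
    rw [Real.norm_eq_abs, abs_mul]
    calc |w n| * |∑ k ∈ Finset.Icc 0 n, c k| ≤ x / n * B :=
          mul_le_mul hwn hS (abs_nonneg _) (by positivity)
      _ = B * x / n := by ring
  have hDw_abs : ∀ t : ℝ, 1 ≤ t → |Dw t| ≤ (x + 2 * x * X) * t ^ (-2 : ℝ) := by
    intro t ht
    have ht0 : 0 < t := by linarith
    have he : Real.exp (-(X / t ^ 2)) ≤ 1 := Real.exp_le_one_iff.2 (by
      have : 0 ≤ X / t ^ 2 := by positivity
      linarith)
    have he0 : 0 < Real.exp (-(X / t ^ 2)) := Real.exp_pos _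
    have hrp : t ^ (-2 : ℝ) = (t ^ 2)⁻¹ := by
      rw [show (-2 : ℝ) = -(2 : ℕ) by norm_num, Real.rpow_neg ht0.le, Real.rpow_natCast]
    rw [hrp]
    simp only [hDw]
    have h1 : |x * (-(t ^ 2)⁻¹) * Real.exp (-(X / t ^ 2))| ≤ x * (t ^ 2)⁻¹ := by
      rw [abs_mul, abs_mul, abs_of_pos hx, abs_neg, abs_of_pos (by positivity), Real.abs_exp]
      calc x * (t ^ 2)⁻¹ * Real.exp (-(X / t ^ 2)) ≤ x * (t ^ 2)⁻¹ * 1 := by gcongr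
        _ = x * (t ^ 2)⁻¹ := mul_one _
    have h2 : |x * t⁻¹ * (Real.exp (-(X / t ^ 2)) * (2 * X / t ^ 3))| ≤ 2 * x * X * (t ^ 2)⁻¹ := by
      rw [abs_mul, abs_mul, abs_mul, abs_of_pos hx, abs_of_pos (by positivity : (0 : ℝ) < t⁻¹),
        Real.abs_exp, abs_of_pos (by positivity : (0 : ℝ) < 2 * X / t ^ 3)]
      have ht4 : t⁻¹ * (2 * X / t ^ 3) ≤ 2 * X * (t ^ 2)⁻¹ := by
        rw [show t⁻¹ * (2 * X / t ^ 3) = 2 * X * (t ^ 2)⁻¹ * (t ^ 2)⁻¹ by field_simp]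
        have : (t ^ 2)⁻¹ ≤ 1 := inv_le_one_of_one_le₀ (by nlinarith)
        calc 2 * X * (t ^ 2)⁻¹ * (t ^ 2)⁻¹ ≤ 2 * X * (t ^ 2)⁻¹ * 1 := by gcongr
          _ = 2 * X * (t ^ 2)⁻¹ := mul_one _
      calc x * t⁻¹ * (Real.exp (-(X / t ^ 2)) * (2 * X / t ^ 3))
          = x * Real.exp (-(X / t ^ 2)) * (t⁻¹ * (2 * X / t ^ 3)) := by ring
        _ ≤ x * 1 * (2 * X * (t ^ 2)⁻¹) := by gcongr
        _ = 2 * x * X * (t ^ 2)⁻¹ := by ring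
    calc |x * (-(t ^ 2)⁻¹) * Real.exp (-(X / t ^ 2)) + x * t⁻¹ * (Real.exp (-(X / t ^ 2)) * (2 * X / t ^ 3))|
        ≤ |x * (-(t ^ 2)⁻¹) * Real.exp (-(X / t ^ 2))| + |x * t⁻¹ * (Real.exp (-(X / t ^ 2)) * (2 * X / t ^ 3))| :=
          abs_add_le _ _
      _ ≤ x * (t ^ 2)⁻¹ + 2 * x * X * (t ^ 2)⁻¹ := add_le_add h1 h2
      _ = (x + 2 * x * X) * (t ^ 2)⁻¹ := by ring
  have hg_dom : G =O[atTop] fun t : ℝ ↦ B * (x + 2 * x * X) * t ^ (-2 : ℝ) := by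
    refine IsBigO.of_bound 1 ?_
    filter_upwards [eventually_ge_atTop (1 : ℝ)] with t ht
    have ht0 : 0 < t := by linarith
    simp only [hG]
    rw [hderiv t ht0.ne', hcS, one_mul, Real.norm_eq_abs, abs_mul, Real.norm_of_nonneg (by positivity)]
    calc |Dw t| * |moebiusDivSum t| ≤ (x + 2 * x * X) * t ^ (-2 : ℝ) * B :=
          mul_le_mul (hDw_abs t ht) (hgB t) (abs_nonneg _) (by positivity)
      _ = B * (x + 2 * x * X) * t ^ (-2 : ℝ) := by ring
  have hg_int : IntegrableAtFilter (fun t : ℝ ↦ B * (x + 2 * x * X) * t ^ (-2 : ℝ)) atTop :=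
    ⟨Set.Ioi 1, Ioi_mem_atTop 1, (integrableOn_Ioi_rpow_of_lt (by norm_num) one_pos).const_mul _⟩
  have habel := tendsto_sum_mul_atTop_nhds_one_sub_integral₀ c hc0 hf_diff hf_int h_lim hg_dom hg_int
  have hR : Tendsto (fun n : ℕ ↦ ∑ k ∈ Finset.Icc 0 n, w k * c k) atTop (𝓝 (rieszFunction X / x)) := by
    have h := (hsumm.hasSum.tendsto_sum_nat).comp (tendsto_add_atTop_nat 1)
    rw [← hF] at h
    refine h.congr fun n ↦ ?_
    simp only [Function.comp_apply, Nat.range_succ_eq_Icc_zero]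
  have hRint : rieszFunction X / x = -∫ u in Set.Ioi (1 : ℝ), G u := by
    have := tendsto_nhds_unique hR habel
    rw [this, zero_sub]
  -- Step 3: integrability of `G` on `[1,∞)`, vanishing on `(0,1)`
  have hGint : IntegrableOn G (Set.Ici 1) :=
    (locallyIntegrableOn_mul_sum_Icc c zero_le_one hf_int).integrableOn_of_isBigO_atTop hg_dom hg_int
  have hG0 : ∀ u ∈ Set.Ioo (0 : ℝ) 1, G u = 0 := by
    intro u hu
    simp only [hG]
    rw [Nat.floor_eq_zero.2 hu.2, Finset.Icc_self, Finset.sum_singleton, hc0, mul_zero]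
  have hGint0 : IntegrableOn G (Set.Ioo 0 1) :=
    integrableOn_zero.congr_fun (fun u hu ↦ (hG0 u hu).symm) measurableSet_Ioo
  have hsplit : ∫ u in Set.Ioi (0 : ℝ), G u = ∫ u in Set.Ioi (1 : ℝ), G u := by
    have hdisj : Disjoint (Set.Ioo (0 : ℝ) 1) (Set.Ici 1) :=
      Set.disjoint_left.2 fun u hu hu' ↦ (not_le.2 hu.2) (Set.mem_Ici.1 hu')
    rw [← Set.Ioo_union_Ici_eq_Ioi zero_lt_one, setIntegral_union hdisj measurableSet_Ici hGint0 hGint,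
      setIntegral_eq_zero_of_forall_eq_zero hG0, zero_add, integral_Ici_eq_integral_Ioi]
  -- Step 4: the integrand of `Gα(x)` is `(-x) · G(xt)`
  have hpt : ∀ t ∈ Set.Ioi (0 : ℝ),
      (moebiusDivSum (x * t) : ℂ) *
          ((((1 / t) * (1 - 2 * (1 / t) ^ 2) * Real.exp (-(1 / t) ^ 2)) : ℝ) : ℂ) / t =
        (((-x) * G (x * t) : ℝ) : ℂ) := by
    intro t ht
    have ht0 : (0 : ℝ) < t := ht
    have hxt : x * t ≠ 0 := by positivity
    have hL : (moebiusDivSum (x * t) : ℂ) *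
          ((((1 / t) * (1 - 2 * (1 / t) ^ 2) * Real.exp (-(1 / t) ^ 2)) : ℝ) : ℂ) / t =
        (((moebiusDivSum (x * t) * ((1 / t) * (1 - 2 * (1 / t) ^ 2) * Real.exp (-(1 / t) ^ 2)) / t) : ℝ) : ℂ) := by
      push_cast; ring
    rw [hL]
    congr 1
    simp only [hG]
    rw [hderiv (x * t) hxt, hcS]
    simp only [hDw]
    have e1 : Real.exp (-(X / (x * t) ^ 2)) = Real.exp (-(1 / t) ^ 2) := by
      congr 1
      rw [hXdef]
      field_simp
    rw [e1, hXdef]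
    field_simp
    ring
  -- assemble
  unfold moebiusConv
  rw [setIntegral_congr_fun measurableSet_Ioi hpt, integral_complex_ofReal, integral_const_mul,
    integral_comp_mul_left_Ioi G 0 hx, mul_zero, hsplit, smul_eq_mul, hRint]
  push_cast
  have hx' : (x : ℂ) ≠ 0 := Complex.ofReal_ne_zero.2 hx.ne'
  field_simp

end BaezDuarteMellin

open BaezDuarteMellin in
/-- **Theorem 4.4 (corrected range) for Riesz's `α`**: `Gα` — which by (3.7) is `x⁻¹R(x²)`, `R`
Riesz's function (`BaezDuarteMellin.moebiusConv_hlAlpha_eq`) — oscillates: there is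
`ϑ ∈ [0, 1/2]` with `x^{ϑ+ε} Re Gα(x) > C` and `< C` for arbitrarily large `x`, every `ε > 0`, every
`C`. Unconditional. [cite: BaezDuarte2005Moebius, Thm. 4.4 and §4 closing remark (p. 3607: "the above results apply to Riesz's … function through (3.7)")] -/
theorem moebiusConv_hlAlpha_oscillation :
    ∃ ϑ : ℝ, 0 ≤ ϑ ∧ ϑ ≤ 1 / 2 ∧ ∀ ε : ℝ, 0 < ε → ∀ C : ℝ,
      (∃ᶠ x : ℝ in atTop, C < x ^ (ϑ + ε) *
        (moebiusConv (fun u : ℝ ↦ (((u * (1 - 2 * u ^ 2) * Real.exp (-u ^ 2)) : ℝ) : ℂ)) x).re) ∧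
      (∃ᶠ x : ℝ in atTop, x ^ (ϑ + ε) *
        (moebiusConv (fun u : ℝ ↦ (((u * (1 - 2 * u ^ 2) * Real.exp (-u ^ 2)) : ℝ) : ℂ)) x).re < C) :=
  BaezDuarte2005Moebius_thm_4_4_corrected (δ₀ := 1 / 2) (by norm_num) isMellinProper_hlAlpha
    (fun u _ => Complex.ofReal_im _)
    (fun σ _ h2 => hasFiniteMellinNorm_hlAlpha (by linarith))
    (fun s hs => leftMellin_hlAlpha_ne_zero (by rw [hs]; norm_num)
      (by intro h; rw [h, Complex.zero_re] at hs; norm_num at hs))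

open BaezDuarteMellin in
/-- **Unconditional oscillation of Riesz's function `R`** (IJMMS §1, p. 3600 and §4, p. 3607: "the
above results apply to Riesz's … function through `x⁻¹R(x²) = Gα(x)`"): there is `ϑ ∈ [0, 1/2]`
such that for every `ε > 0` and every `C`, `x^{ϑ+ε} · x⁻¹R(x²) > C` and `< C` each hold for
arbitrarily large `x`. [cite: BaezDuarte2005Moebius, §1 p. 3600 and §4 p. 3607 (Thm. 4.4 for α, (3.7))] -/
theorem rieszFunction_oscillation :
    ∃ ϑ : ℝ, 0 ≤ ϑ ∧ ϑ ≤ 1 / 2 ∧ ∀ ε : ℝ, 0 < ε → ∀ C : ℝ,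
      (∃ᶠ x : ℝ in atTop, C < x ^ (ϑ + ε) * (rieszFunction (x ^ 2) / x)) ∧
        (∃ᶠ x : ℝ in atTop, x ^ (ϑ + ε) * (rieszFunction (x ^ 2) / x) < C) := by
  obtain ⟨ϑ, h0, h1, h⟩ := moebiusConv_hlAlpha_oscillation
  refine ⟨ϑ, h0, h1, fun ε hε C => ?_⟩
  obtain ⟨hA, hB⟩ := h ε hε C
  have hev : ∀ᶠ x : ℝ in atTop,
      (moebiusConv (fun u : ℝ ↦ (((u * (1 - 2 * u ^ 2) * Real.exp (-u ^ 2)) : ℝ) : ℂ)) x).re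
        = rieszFunction (x ^ 2) / x := by
    filter_upwards [eventually_gt_atTop (0 : ℝ)] with x hx
    rw [moebiusConv_hlAlpha_eq hx, Complex.ofReal_re]
  constructor
  · refine (hA.and_eventually hev).mono ?_
    rintro x ⟨h1, h2⟩
    rwa [h2] at h1
  · refine (hB.and_eventually hev).mono ?_
    rintro x ⟨h1, h2⟩
    rwa [h2] at h1

/-- **Riesz's function changes sign beyond every bound** ("in contrast with Riesz's statement that
`R(x)` has at least one such zero", IJMMS p. 3600), unconditionally: `R(y) > 0` and `R(y) < 0` each
for arbitrarily large `y`. [cite: BaezDuarte2005Moebius, §1 p. 3600 ("an infinite number of positive, real zeros")] -/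
theorem rieszFunction_frequently_pos_and_neg :
    (∃ᶠ y : ℝ in atTop, 0 < rieszFunction y) ∧ (∃ᶠ y : ℝ in atTop, rieszFunction y < 0) := by
  obtain ⟨ϑ, -, -, h⟩ := rieszFunction_oscillation
  obtain ⟨hA, hB⟩ := h 1 one_pos 0
  have hsq : Tendsto (fun x : ℝ => x ^ 2) atTop atTop := tendsto_pow_atTop two_ne_zero
  constructor
  · refine hsq.frequently ((hA.and_eventually (eventually_gt_atTop (0 : ℝ))).mono ?_)
    rintro x ⟨h1, h2⟩
    have h3 : 0 < rieszFunction (x ^ 2) / x := pos_of_mul_pos_right h1 (Real.rpow_nonneg h2.le _)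
    exact (div_pos_iff_of_pos_right h2).1 h3
  · refine hsq.frequently ((hB.and_eventually (eventually_gt_atTop (0 : ℝ))).mono ?_)
    rintro x ⟨h1, h2⟩
    have hx : 0 < x ^ (ϑ + 1) := Real.rpow_pos_of_pos h2 _
    by_contra hneg
    push Not at hneg
    have h4 : 0 ≤ rieszFunction (x ^ 2) / x := div_nonneg hneg h2.le
    have := mul_nonneg hx.le h4
    linarith

/-- **Riesz's function has infinitely many positive real zeros** (IJMMS §1, p. 3600), unconditionally:
beyond every `X` there is a zero of `R` (sign changes + continuity + IVT).
[cite: BaezDuarte2005Moebius, §1 p. 3600] -/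
theorem rieszFunction_exists_zero_gt (X : ℝ) : ∃ y : ℝ, X < y ∧ rieszFunction y = 0 := by
  obtain ⟨hpos, hneg⟩ := rieszFunction_frequently_pos_and_neg
  obtain ⟨y₁, hy₁, h₁⟩ := hpos.forall_exists_of_atTop (X + 1)
  obtain ⟨y₂, hy₂, h₂⟩ := hneg.forall_exists_of_atTop y₁
  have hivt := intermediate_value_Icc' hy₂ continuous_rieszFunction.continuousOn
  obtain ⟨c, hc, hc0⟩ := hivt ⟨h₂.le, h₁.le⟩
  exact ⟨c, by linarith [hc.1], hc0⟩

/-- The set of positive real zeros of Riesz's function `R` is infinite (IJMMS §1, p. 3600).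
[cite: BaezDuarte2005Moebius, §1 p. 3600] -/
theorem rieszFunction_zeros_infinite : {y : ℝ | 0 < y ∧ rieszFunction y = 0}.Infinite := by
  refine Set.infinite_of_forall_exists_gt fun a => ?_
  obtain ⟨y, hy, hy0⟩ := rieszFunction_exists_zero_gt (max a 0)
  exact ⟨y, ⟨lt_of_le_of_lt (le_max_right _ _) hy, hy0⟩, lt_of_le_of_lt (le_max_left _ _) hy⟩

/-! ## Prop. 4.3 without the line hypotheses: the hypothesis-free printed form can fail only under RH (appended) -/

/-- **A one-sided criterion behind IJMMS Prop. 4.3**: if SOME Mellin-proper `φ` has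
`Gφ(x) = O(x^{−1/2})` (no `ε`; in particular if `Gφ = o(x^{−1/2})`), then RH — since then
`Gφ ≪ x^{−1/2+ε}` for every `ε > 0` and Thm. 3.1 (`BaezDuarte2005Moebius_thm_3_1_holds`) applies.
This is the RH half of Thm. 4.1 WITHOUT the continuity/non-vanishing hypotheses on `σ = −1/2`
(which Thm. 4.1 uses only for the simplicity of the zeros).
[cite: BaezDuarte2005Moebius, §4 Thm. 4.1 (proof, first sentence: "the ε-free bound implies the bounds of Thm. 3.5") and Prop. 4.3] -/
theorem riemannHypothesis_of_moebiusConv_isBigO_half {φ : ℝ → ℂ} (hφ : IsMellinProper φ)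
    (h : moebiusConv φ =O[atTop] fun x : ℝ ↦ x ^ (-(1 / 2 : ℝ))) : RiemannHypothesis :=
  (BaezDuarte2005Moebius_thm_3_1_holds φ hφ).2 fun _ hε ↦ BaezDuarteMellin.isBigO_rpow_add hε.le h

/-- **IJMMS Prop. 4.3 AS PRINTED (no hypothesis beyond Mellin-properness) holds whenever RH fails**:
if `¬RH` then `Gφ(x) ≠ o(x^{−1/2})` for every Mellin-proper `φ` (contrapositive of the previous
theorem). Together with `BaezDuarte2005Moebius_prop_4_3` (the printed statement under the tacit
hypotheses of its proof) this localises the open case of the hypothesis-free statement to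
"RH true and `φ^∧` degenerate on `σ = −1/2`". [cite: BaezDuarte2005Moebius, §4 Prop. 4.3 (p. 3607, (4.12))] -/
theorem BaezDuarte2005Moebius_prop_4_3_of_not_riemannHypothesis (hRH : ¬ RiemannHypothesis)
    {φ : ℝ → ℂ} (hφ : IsMellinProper φ) :
    ¬ (moebiusConv φ =o[atTop] fun x : ℝ ↦ x ^ (-(1 / 2 : ℝ))) :=
  fun h ↦ hRH (riemannHypothesis_of_moebiusConv_isBigO_half hφ h.isBigO)

end Literature.NumberTheory.LFunctions

end
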